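import Literature.Topology.FourManifolds.DehnSurgeryFramingProofs
import Mathlib.Analysis.SpecialFunctions.Complex.Arg
import Mathlib.Topology.Algebra.Module.FiniteDimension
import Mathlib.LinearAlgebra.FiniteDimensional.Basic
import Mathlib.LinearAlgebra.Complex.FiniteDimensional
import HarnessLib

/-!
# The linking number of two disjoint knots in `S³` is well defined: proofs

Sibling proof file of `LinkingNumber.lean` (trunk T-4MAN, `FourManL` C5; D-0014 provefact) for
its two named facts on well-definedness:

* `Literature.Knot.hasLinkingNumber_iff_forall_holds : Knot.hasLinkingNumber_iff_forall` (**proved**) —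
  *the linking number does not depend on the oriented tubular neighbourhood and the connecting
  path*;
* `Literature.Knot.existsUnique_hasLinkingNumber_of :
    Knot.TubularNbhd.zpow_meridian_injective → Knot.existsUnique_hasLinkingNumber` (**proved**) —
  *the linking number of two disjoint oriented knots `K`, `J` in `S³` is well defined* (there is a
  unique `l : ℤ` with `K.HasLinkingNumber J h l`, i.e. with `[γ · J · γ⁻¹] = l • [μ_ν]` in
  `H₁(S³ ∖ K) = π₁(S³ ∖ K, ν.basePoint)ᵃᵇ` for some oriented tubular neighbourhood `ν` of `K` and
  connecting path `γ`; Rolfsen, *Knots and Links* (1976), §5.D, definition (2) of `lk(K, J)`), from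
  the named fact `Knot.TubularNbhd.zpow_meridian_injective` of `DehnSurgeryFramingProofs.lean` (the
  meridian has infinite order in `H₁(S³ ∖ K)`), which the tree proves in
  `DehnSurgeryFramingUniqueness.lean` (`Knot.TubularNbhd.zpow_meridian_injective_holds`, Hurewicz
  and Mayer–Vietoris) — so `Knot.existsUnique_hasLinkingNumber` holds by
  `existsUnique_hasLinkingNumber_of zpow_meridian_injective_holds`; existence
  (`HasLinkingNumber.exists`) is unconditional.

The printed argument: `S³ ∖ K` is path connected; `H₁(S³ ∖ K) ≅ ℤ`, generated by the class of a
meridian (Alexander duality), the generator being pinned down by the orientations. The tree now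
contains all the homological inputs:

* `Knot.pathConnectedSpace_complement_holds` (`LinkingNumberProofs.lean`);
* `Knot.TubularNbhd.normalClosure_meridian_eq_top`, `abelianization_mem_zpowers_meridian`
  (`DehnSurgeryFramingProofs.lean`: the knot group is normally generated by the meridian —
  Kervaire's lemma for classical knots, van Kampen);
* `Knot.TubularNbhd.zpow_meridian_injective` (named fact of `DehnSurgeryFramingProofs.lean`,
  proved in `DehnSurgeryFramingUniqueness.lean`: the meridian has infinite order in `H₁(S³ ∖ K)`,
  by the degree-one Hurewicz map and Mayer–Vietoris) — consumed here as the hypothesis `hinj`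
  (this file imports only `DehnSurgeryFramingProofs.lean`).

What this file adds is the **orientation bookkeeping**: the class of the oriented meridian in
`H₁(S³ ∖ K)` does not depend on the oriented (`det_pos`) tubular neighbourhood:

* `Literature.Topology.FourManifolds.Knot.TubularNbhd.loopConj_meridian`, `abelianizationOf_conj_meridian_eq` — **the oriented
  meridians of any two oriented tubular neighbourhoods `ν`, `ν'` of `K` are freely homotopic in
  `S³ ∖ K`**, hence `[δ⁻¹ · μ_ν · δ]ᵃᵇ = [μ_{ν'}]ᵃᵇ` for every connecting path `δ`. Proof
  (elementary and extrinsic in `ℝ⁴ ⊇ 𝕊³`; no inverse function theorem, no charts): with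
  `p = γ(0)`, `T = γ'(0)` (velocity of the knot, `SphereEmbedding.curve/tangent` of
  `DehnSurgeryTubularNbhdProofs.lean`) and the frame `(p, T, ∂₁ν', ∂₂ν')` of `ℝ⁴` (a basis by
  `det_pos` of `ν'`), Cramer's rule gives a tangential coordinate `Λ` and complex normal
  coordinates `Φ` (`coordT`, `coordC`; multilinearity of `frameDet` and a Plücker relation,
  `frameDet_pluecker`); the linearised normal map `M = Φ ∘ dν_{(x₀,0)}` of `ν` in this frame has
  determinant `[p,T,∂₁ν,∂₂ν] / [p,T,∂₁ν',∂₂ν'] > 0` (`det_normalMap_pos`: both `det_pos`). Near `p`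
  the knot lies in the thin cone `‖Φ‖ ≤ η |Λ|` (`SphereEmbedding.exists_cone`:
  `γ(θ) = p + θ T + o(θ)`), whereas the straight-line homotopy from the small meridian
  `ν(x₀, r e^{2πit})` to the linear loop `p + L(M(r e^{2πit}))` (`L` the normal lift) and the
  deformation `defMap` of the positively oriented `M` to the identity (`P ↝ 1` through
  `e^{(1-s) log P}`, `Q/P ↝ i` through the upper half plane) stay, after radial projection to
  `𝕊³`, in the anti-cone `η |Λ| < ‖Φ‖`, hence in `S³ ∖ K` (`loopConj_smallMeridian_linLoop`,
  `loopConj_linLoop_id`); with the radial homotopies in the punctured fibres this chains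
  `μ_ν ~ μ_ν^r ~ Y_M ~ Y_1 ~ Y_{M'} ~ μ_{ν'}^r ~ μ_{ν'}`. Free homotopies are handled algebraically
  as conjugacy in the fundamental groupoid (`Literature.Topology.FourManifolds.LoopConj`; `LoopConj.of_square` from the square
  lemma of `VanKampenKernel.lean`, Hatcher §1.1 Exercise 6);
* `Literature.Topology.FourManifolds.Knot.HasLinkingNumber.exists`, `.transport`, `.unique_of`, and the two discharges.

## Other declarations

* `Literature.Topology.FourManifolds.LoopConj` and its algebra (`refl/symm/trans/map/of_square/abelianizationOf_eq`),
  `Literature.Topology.FourManifolds.Path.Homotopic.Quotient.symm_symm'`, `trans_symm'`;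
* `Literature.Topology.FourManifolds.frameDet_add_row₁` … `frameDet_pluecker`, `Literature.Topology.FourManifolds.coordT`, `Literature.Topology.FourManifolds.coordC`, `Literature.Topology.FourManifolds.ofCL`
  (`ℂ →L[ℝ] ℝ²`), `Literature.Topology.FourManifolds.circ`, `Literature.Topology.FourManifolds.defMap`, `Literature.Topology.FourManifolds.Knot.complPt`, `Literature.Topology.FourManifolds.clm_apply_eq_re_im`,
  `Literature.Topology.FourManifolds.exists_mul_norm_le_of_det_ne_zero`;
* `Literature.Topology.FourManifolds.Knot.TubularNbhd.fibreMap`, `fibreDeriv`, `normalVec` (`∂ᵢν` at the base point;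
  `frameDet_normalVec_pos` is `det_pos` at `(0, 0)`), `fibrePoint`, `smallMeridian`, `tanCoord`,
  `norCoord`, `normalMap`, `normalLift`, `linPt`, `linLoop`;
* `Literature.Topology.FourManifolds.fundamentalGroupMulEquivOfPath_fromPath` / `_symm_fromPath`: Mathlib's change of base point
  `FundamentalGroup.fundamentalGroupMulEquivOfPath δ` is `[α] ↦ [δ⁻¹ · α · δ]` (`rfl`).

## Sources

* D. Rolfsen, *Knots and Links*, Publish or Perish (1976), §5.D (linking numbers; definition (2);
  independence of the choices) [Rolfsen1976]. (Not held by the literature store at the time of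
  writing; acquisition requested.)
* R. H. Crowell, R. H. Fox, *Introduction to Knot Theory* (1963; GTM 57, 1977), Ch. VIII §1,
  (1.1)–(1.2) (the abelianised knot group is infinite cyclic, every meridian generator mapping to
  a generator) [CrowellFox1963].
* A. Hatcher, *Algebraic Topology* (2002), §1.1 (change of base point; Exercise 6: free homotopy
  classes are conjugacy classes) [HatcherAT2002].

## Design notes

* No statement of `LinkingNumber.lean`, `KnotGroup.lean`, `DehnSurgery.lean` is modified and no
  named fact (`def … : Prop`) is introduced.
* All calculus is extrinsic in `ℝ⁴ ⊇ 𝕊³` (`SphereEmbedding.curve/tangent`, `frameDet`); only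
  first derivatives at one point and first-order Taylor estimates
  (`hasFDerivAt_iff_isLittleO_nhds_zero`) are used.
* No declaration in this file uses `sorry`; `hasLinkingNumber_iff_forall_holds` and
  `existsUnique_hasLinkingNumber_of` depend only on the axioms `propext`, `Classical.choice`,
  `Quot.sound`.
-/

noncomputable section

open Set Function unitInterval
open scoped Topology Manifold ContDiff Real

namespace Literature.Topology.FourManifolds

/-- Local notation: `𝔼 n` is the model Euclidean space `EuclideanSpace ℝ (Fin n)`. -/
local notation "𝔼 " n:arg => EuclideanSpace ℝ (Fin n)

/-- Local notation: `𝕊 n` is the unit sphere in `EuclideanSpace ℝ (Fin (n + 1))`. -/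
local notation "𝕊 " n:arg => (Metric.sphere (0 : EuclideanSpace ℝ (Fin (n + 1))) 1)

/-! ### Conjugate loops in the fundamental groupoid (free homotopy classes) -/

section LoopConj

variable {X : Type*} [TopologicalSpace X] {x₀ x₁ x₂ : X}

omit x₂ in
/-- `(p⁻¹)⁻¹ = p` in the fundamental groupoid. [folklore] -/
@[simp] theorem Path.Homotopic.Quotient.symm_symm' (p : Path.Homotopic.Quotient x₀ x₁) :
    p.symm.symm = p := by
  induction p using Path.Homotopic.Quotient.ind with
  | mk a =>
    rw [← Path.Homotopic.Quotient.mk_symm, ← Path.Homotopic.Quotient.mk_symm, Path.symm_symm]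

/-- `(p · q)⁻¹ = q⁻¹ · p⁻¹` in the fundamental groupoid. [folklore] -/
@[simp] theorem Path.Homotopic.Quotient.trans_symm' (p : Path.Homotopic.Quotient x₀ x₁)
    (q : Path.Homotopic.Quotient x₁ x₂) : (p.trans q).symm = q.symm.trans p.symm := by
  induction p using Path.Homotopic.Quotient.ind with
  | mk a =>
    induction q using Path.Homotopic.Quotient.ind with
    | mk b =>
      rw [← Path.Homotopic.Quotient.mk_trans, ← Path.Homotopic.Quotient.mk_symm, Path.trans_symm,
        Path.Homotopic.Quotient.mk_trans, Path.Homotopic.Quotient.mk_symm,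
        Path.Homotopic.Quotient.mk_symm]

/-- Loops `β₀` at `x₀` and `β₁` at `x₁` are **conjugate in the fundamental groupoid**:
`[β₁] = [τ⁻¹ · β₀ · τ]` for some path `τ` from `x₀` to `x₁`. This is the algebraic form of
"freely homotopic" (`LoopConj.of_square`). [folklore] -/
def LoopConj (β₀ : Path x₀ x₀) (β₁ : Path x₁ x₁) : Prop :=
  ∃ τ : Path x₀ x₁, Path.Homotopic.Quotient.mk β₁ =
    Path.Homotopic.Quotient.mk (τ.symm.trans (β₀.trans τ))

omit x₂ in
/-- Homotopic loops are conjugate (by the constant path). [folklore] -/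
theorem LoopConj.of_homotopic {β₀ β₁ : Path x₀ x₀} (h : β₀.Homotopic β₁) : LoopConj β₀ β₁ := by
  refine ⟨Path.refl x₀, ?_⟩
  rw [← Path.Homotopic.Quotient.eq.2 h]
  simp only [Path.Homotopic.Quotient.mk_trans, Path.Homotopic.Quotient.mk_symm,
    Path.Homotopic.Quotient.mk_refl]
  rw [Path.Homotopic.Quotient.trans_refl,
    show (Path.Homotopic.Quotient.refl x₀).symm = Path.Homotopic.Quotient.refl x₀ from rfl,
    Path.Homotopic.Quotient.refl_trans]

/-- A loop is conjugate to itself. [folklore] -/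
theorem LoopConj.refl (β : Path x₀ x₀) : LoopConj β β :=
  LoopConj.of_homotopic (Path.Homotopic.refl β)

/-- Pointwise equal loops are conjugate. [folklore] -/
theorem LoopConj.of_eq {β₀ β₁ : Path x₀ x₀} (h : ∀ t, β₀ t = β₁ t) : LoopConj β₀ β₁ := by
  obtain rfl : β₀ = β₁ := Path.ext (funext h)
  exact LoopConj.refl β₀

/-- Conjugacy of loops is symmetric. [folklore] -/
theorem LoopConj.symm {β₀ : Path x₀ x₀} {β₁ : Path x₁ x₁} (h : LoopConj β₀ β₁) :
    LoopConj β₁ β₀ := by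
  obtain ⟨τ, hτ⟩ := h
  refine ⟨τ.symm, ?_⟩
  simp only [Path.Homotopic.Quotient.mk_trans, Path.Homotopic.Quotient.mk_symm] at hτ ⊢
  rw [hτ]
  simp only [Path.Homotopic.Quotient.symm_symm', Path.Homotopic.Quotient.trans_assoc,
    Literature.AlgebraicTopology.FundamentalGroup.VanKampen.trans_symm_cancel, Path.Homotopic.Quotient.trans_symm,
    Path.Homotopic.Quotient.trans_refl]

/-- Conjugacy of loops is transitive (compose the conjugating paths). [folklore] -/
theorem LoopConj.trans {β₀ : Path x₀ x₀} {β₁ : Path x₁ x₁} {β₂ : Path x₂ x₂} (h₁ : LoopConj β₀ β₁)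
    (h₂ : LoopConj β₁ β₂) : LoopConj β₀ β₂ := by
  obtain ⟨τ₁, hτ₁⟩ := h₁
  obtain ⟨τ₂, hτ₂⟩ := h₂
  refine ⟨τ₁.trans τ₂, ?_⟩
  simp only [Path.Homotopic.Quotient.mk_trans, Path.Homotopic.Quotient.mk_symm] at hτ₁ hτ₂ ⊢
  rw [hτ₂, hτ₁]
  simp only [Path.Homotopic.Quotient.trans_symm', Path.Homotopic.Quotient.trans_assoc]

/-- Conjugacy of loops is preserved by continuous maps. [folklore] -/
theorem LoopConj.map {Y : Type*} [TopologicalSpace Y] {β₀ : Path x₀ x₀} {β₁ : Path x₁ x₁}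
    (h : LoopConj β₀ β₁) (f : C(X, Y)) : LoopConj (β₀.map f.continuous) (β₁.map f.continuous) := by
  obtain ⟨τ, hτ⟩ := h
  refine ⟨τ.map f.continuous, ?_⟩
  rw [Path.map_symm, ← Path.map_trans, ← Path.map_trans, Path.Homotopic.Quotient.mk_map,
    Path.Homotopic.Quotient.mk_map, hτ]

/-- **Freely homotopic loops are conjugate**: if `F : I × I → X` has closed slices
`F (s, 0) = F (s, 1)`, the loops `F (0, ·)` and `F (1, ·)` are conjugate by the base track
`s ↦ F (s, 0)` (the square lemma: "bottom · right ≃ left · top"). [folklore] -/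
theorem LoopConj.of_square (F : C(I × I, X)) (hF : ∀ s, F (s, 0) = F (s, 1)) (β₀ : Path x₀ x₀)
    (β₁ : Path x₁ x₁) (h₀ : ∀ t, β₀ t = F (0, t)) (h₁ : ∀ t, β₁ t = F (1, t)) : LoopConj β₀ β₁ := by
  have hx₀ : F (0, 0) = x₀ := (h₀ 0).symm.trans β₀.source
  have hx₁ : F (1, 0) = x₁ := (h₁ 0).symm.trans β₁.source
  let τ : Path x₀ x₁ :=
    { toFun := fun s => F (s, 0)
      continuous_toFun := by fun_prop
      source' := hx₀
      target' := hx₁ }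
  have hsq := Literature.AlgebraicTopology.FundamentalGroup.VanKampen.homotopicWithin_of_square (S := univ) F (fun _ => mem_univ _) β₀ τ τ β₁ h₀
    (fun s => hF s) (fun s => rfl) h₁
  obtain ⟨G, -⟩ := hsq
  have e : (Path.Homotopic.Quotient.mk β₀).trans (Path.Homotopic.Quotient.mk τ) =
      (Path.Homotopic.Quotient.mk τ).trans (Path.Homotopic.Quotient.mk β₁) := by
    rw [← Path.Homotopic.Quotient.mk_trans, ← Path.Homotopic.Quotient.mk_trans]
    exact Path.Homotopic.Quotient.eq.2 ⟨G⟩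
  refine ⟨τ, ?_⟩
  simp only [Path.Homotopic.Quotient.mk_trans, Path.Homotopic.Quotient.mk_symm]
  rw [e, Literature.AlgebraicTopology.FundamentalGroup.VanKampen.symm_trans_cancel]

/-- **Conjugate loops have the same image in the abelianised fundamental group, after any
change of base point**: if `[β₁] = [τ⁻¹ β₀ τ]` then `[δ⁻¹ β₀ δ]ᵃᵇ = [β₁]ᵃᵇ` for every path `δ`
from `x₀` to `x₁` (the two differ by conjugation by the loop `τ⁻¹ δ`). [folklore] -/
theorem LoopConj.abelianizationOf_eq {β₀ : Path x₀ x₀} {β₁ : Path x₁ x₁} (h : LoopConj β₀ β₁)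
    (δ : Path x₀ x₁) :
    Abelianization.of (FundamentalGroup.fromPath
        (Path.Homotopic.Quotient.mk (δ.symm.trans (β₀.trans δ)))) =
      Abelianization.of (FundamentalGroup.fromPath (Path.Homotopic.Quotient.mk β₁) :
        FundamentalGroup X x₁) := by
  obtain ⟨τ, hτ⟩ := h
  -- the conjugating loop `g = τ⁻¹ δ` at `x₁`
  let g : FundamentalGroup X x₁ := FundamentalGroup.fromPath
    ((Path.Homotopic.Quotient.mk τ).symm.trans (Path.Homotopic.Quotient.mk δ))
  have key : (FundamentalGroup.fromPath (Path.Homotopic.Quotient.mk (δ.symm.trans (β₀.trans δ))) :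
      FundamentalGroup X x₁) =
      g * FundamentalGroup.fromPath (Path.Homotopic.Quotient.mk β₁) * g⁻¹ := by
    rw [hτ]
    simp only [g, FundamentalGroup.fromPath, FundamentalGroup.fromArrow, FundamentalGroup.mul_def,
      FundamentalGroup.inv_def, Path.Homotopic.Quotient.mk_trans, Path.Homotopic.Quotient.mk_symm]
    rw [← Path.Homotopic.Quotient.mk_symm δ, ← Path.Homotopic.Quotient.mk_symm τ,
      ← Path.Homotopic.Quotient.mk_trans, ← Path.Homotopic.Quotient.mk_trans,
      ← Path.Homotopic.Quotient.mk_trans, ← Path.Homotopic.Quotient.mk_trans,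
      ← Path.Homotopic.Quotient.mk_trans, ← Path.Homotopic.Quotient.mk_symm,
      ← Path.Homotopic.Quotient.mk_trans, ← Path.Homotopic.Quotient.mk_trans, Path.trans_symm,
      Path.symm_symm]
    simp only [Path.Homotopic.Quotient.mk_trans, Path.Homotopic.Quotient.mk_symm,
      Path.Homotopic.Quotient.trans_assoc, Literature.AlgebraicTopology.FundamentalGroup.VanKampen.trans_symm_cancel]
  rw [key, map_mul, map_mul, mul_right_comm, map_inv, mul_inv_cancel, one_mul]

end LoopConj

/-! ### Change of base point in the fundamental group -/

section BasePoint

variable {X : Type*} [TopologicalSpace X] {x₀ x₁ : X}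

/-- Mathlib's change-of-base-point isomorphism `π₁(X, x₀) ≃* π₁(X, x₁)` along a path `δ` sends the
class of a loop `α` to the class of `δ⁻¹ · α · δ`. [folklore] -/
theorem fundamentalGroupMulEquivOfPath_fromPath (δ : Path x₀ x₁) (α : Path x₀ x₀) :
    FundamentalGroup.fundamentalGroupMulEquivOfPath δ
        (FundamentalGroup.fromPath (Path.Homotopic.Quotient.mk α)) =
      FundamentalGroup.fromPath (Path.Homotopic.Quotient.mk (δ.symm.trans (α.trans δ))) := rfl

/-- The inverse change-of-base-point isomorphism sends the class of a loop `β` at `x₁` to the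
class of `δ · β · δ⁻¹`. [folklore] -/
theorem fundamentalGroupMulEquivOfPath_symm_fromPath (δ : Path x₀ x₁) (β : Path x₁ x₁) :
    (FundamentalGroup.fundamentalGroupMulEquivOfPath δ).symm
        (FundamentalGroup.fromPath (Path.Homotopic.Quotient.mk β)) =
      FundamentalGroup.fromPath (Path.Homotopic.Quotient.mk (δ.trans (β.trans δ.symm))) := rfl

end BasePoint

/-! ## Orientation consistency of meridians -/

/-! ### More on the four-vector determinant `frameDet` -/

section FrameDet

/-- Additivity of `frameDet` in the second row. [folklore] -/
theorem frameDet_add_row₁ (r₀ u v r₂ r₃ : 𝔼 4) :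
    frameDet r₀ (u + v) r₂ r₃ = frameDet r₀ u r₂ r₃ + frameDet r₀ v r₂ r₃ := by
  simp only [frameDet_expand, PiLp.add_apply]
  ring

/-- Homogeneity of `frameDet` in the second row. [folklore] -/
theorem frameDet_smul_row₁ (r₀ r₁ r₂ r₃ : 𝔼 4) (c : ℝ) :
    frameDet r₀ (c • r₁) r₂ r₃ = c * frameDet r₀ r₁ r₂ r₃ := by
  simp only [frameDet_expand, PiLp.smul_apply, smul_eq_mul]
  ring

/-- Additivity of `frameDet` in the third row. [folklore] -/
theorem frameDet_add_row₂ (r₀ r₁ u v r₃ : 𝔼 4) :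
    frameDet r₀ r₁ (u + v) r₃ = frameDet r₀ r₁ u r₃ + frameDet r₀ r₁ v r₃ := by
  simp only [frameDet_expand, PiLp.add_apply]
  ring

/-- Homogeneity of `frameDet` in the third row. [folklore] -/
theorem frameDet_smul_row₂ (r₀ r₁ r₂ r₃ : 𝔼 4) (c : ℝ) :
    frameDet r₀ r₁ (c • r₂) r₃ = c * frameDet r₀ r₁ r₂ r₃ := by
  simp only [frameDet_expand, PiLp.smul_apply, smul_eq_mul]
  ring

/-- Additivity of `frameDet` in the fourth row. [folklore] -/
theorem frameDet_add_row₃ (r₀ r₁ r₂ u v : 𝔼 4) :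
    frameDet r₀ r₁ r₂ (u + v) = frameDet r₀ r₁ r₂ u + frameDet r₀ r₁ r₂ v := by
  simp only [frameDet_expand, PiLp.add_apply]
  ring

/-- Homogeneity of `frameDet` in the fourth row. [folklore] -/
theorem frameDet_smul_row₃ (r₀ r₁ r₂ r₃ : 𝔼 4) (c : ℝ) :
    frameDet r₀ r₁ r₂ (c • r₃) = c * frameDet r₀ r₁ r₂ r₃ := by
  simp only [frameDet_expand, PiLp.smul_apply, smul_eq_mul]
  ring

/-- `frameDet` vanishes when the first two rows coincide. [folklore] -/
theorem frameDet_self₀₁ (r₀ r₂ r₃ : 𝔼 4) : frameDet r₀ r₀ r₂ r₃ = 0 := by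
  simp only [frameDet_expand]; ring

/-- `frameDet` vanishes when the first and third rows coincide. [folklore] -/
theorem frameDet_self₀₂ (r₀ r₁ r₃ : 𝔼 4) : frameDet r₀ r₁ r₀ r₃ = 0 := by
  simp only [frameDet_expand]; ring

/-- `frameDet` vanishes when the first and fourth rows coincide. [folklore] -/
theorem frameDet_self₀₃ (r₀ r₁ r₂ : 𝔼 4) : frameDet r₀ r₁ r₂ r₀ = 0 := by
  simp only [frameDet_expand]; ring

/-- `frameDet` vanishes when the second and third rows coincide. [folklore] -/
theorem frameDet_self₁₂ (r₀ r₁ r₃ : 𝔼 4) : frameDet r₀ r₁ r₁ r₃ = 0 := by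
  simp only [frameDet_expand]; ring

/-- `frameDet` vanishes when the second and fourth rows coincide. [folklore] -/
theorem frameDet_self₁₃ (r₀ r₁ r₂ : 𝔼 4) : frameDet r₀ r₁ r₂ r₁ = 0 := by
  simp only [frameDet_expand]; ring

/-- `frameDet` vanishes when the last two rows coincide. [folklore] -/
theorem frameDet_self₂₃ (r₀ r₁ r₂ : 𝔼 4) : frameDet r₀ r₁ r₂ r₂ = 0 := by
  simp only [frameDet_expand]; ring

set_option maxHeartbeats 4000000 in
/-- **Plücker relation for bordered determinants**: with the first two rows fixed, the
`2 × 2` minors of the map `(u, v) ↦ frameDet r₀ r₁ u v` satisfy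
`D · [u, v] = [u, r₃][r₂, v] - [v, r₃][r₂, u]`, `D = [r₂, r₃]`; it expresses that the last two
coordinates with respect to the frame `(r₀, r₁, r₂, r₃)` compute `frameDet r₀ r₁ u v / D`. Proved
as a polynomial identity. [folklore] -/
theorem frameDet_pluecker (r₀ r₁ r₂ r₃ u v : 𝔼 4) :
    frameDet r₀ r₁ r₂ r₃ * frameDet r₀ r₁ u v =
      frameDet r₀ r₁ u r₃ * frameDet r₀ r₁ r₂ v - frameDet r₀ r₁ v r₃ * frameDet r₀ r₁ r₂ u := by
  simp only [frameDet_expand]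
  ring

end FrameDet

/-! ### Coordinates with respect to a frame of `ℝ⁴` -/

section Coordinates

variable (r₀ r₁ r₂ r₃ : 𝔼 4)

/-- The coordinate along `r₁` with respect to the frame `(r₀, r₁, r₂, r₃)` (Cramer's rule):
`v ↦ [r₀, v, r₂, r₃] / [r₀, r₁, r₂, r₃]`, a linear functional with value `1` on `r₁` and `0`
on `r₀, r₂, r₃`. [folklore] -/
def coordT : 𝔼 4 →ₗ[ℝ] ℝ where
  toFun v := frameDet r₀ v r₂ r₃ / frameDet r₀ r₁ r₂ r₃
  map_add' u v := by simp only [frameDet_add_row₁, add_div]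
  map_smul' c v := by simp only [frameDet_smul_row₁, RingHom.id_apply, smul_eq_mul, mul_div_assoc]

/-- The last two coordinates with respect to the frame `(r₀, r₁, r₂, r₃)`, as a complex number:
`v ↦ [r₀, r₁, v, r₃] / D + i [r₀, r₁, r₂, v] / D`, `D = [r₀, r₁, r₂, r₃]`. [folklore] -/
def coordC : 𝔼 4 →ₗ[ℝ] ℂ where
  toFun v :=
    ⟨frameDet r₀ r₁ v r₃ / frameDet r₀ r₁ r₂ r₃, frameDet r₀ r₁ r₂ v / frameDet r₀ r₁ r₂ r₃⟩
  map_add' u v := by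
    apply Complex.ext <;> simp [frameDet_add_row₂, frameDet_add_row₃, add_div]
  map_smul' c v := by
    apply Complex.ext <;>
      simp [frameDet_smul_row₂, frameDet_smul_row₃, mul_div_assoc]

/-- Formula for `coordT`. [folklore] -/
theorem coordT_apply (v : 𝔼 4) :
    coordT r₀ r₁ r₂ r₃ v = frameDet r₀ v r₂ r₃ / frameDet r₀ r₁ r₂ r₃ := rfl

/-- Real part of `coordC`. [folklore] -/
theorem coordC_apply_re (v : 𝔼 4) :
    (coordC r₀ r₁ r₂ r₃ v).re = frameDet r₀ r₁ v r₃ / frameDet r₀ r₁ r₂ r₃ := rfl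

/-- Imaginary part of `coordC`. [folklore] -/
theorem coordC_apply_im (v : 𝔼 4) :
    (coordC r₀ r₁ r₂ r₃ v).im = frameDet r₀ r₁ r₂ v / frameDet r₀ r₁ r₂ r₃ := rfl

/-- `coordT` is continuous. [folklore] -/
theorem continuous_coordT : Continuous (coordT r₀ r₁ r₂ r₃) :=
  LinearMap.continuous_of_finiteDimensional _

/-- `coordC` is continuous. [folklore] -/
theorem continuous_coordC : Continuous (coordC r₀ r₁ r₂ r₃) :=
  LinearMap.continuous_of_finiteDimensional _

variable {r₀ r₁ r₂ r₃}

/-- `coordT r₀ = 0`. [folklore] -/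
theorem coordT_row₀ : coordT r₀ r₁ r₂ r₃ r₀ = 0 := by
  rw [coordT_apply, frameDet_self₀₁, zero_div]

/-- `coordT r₁ = 1`. [folklore] -/
theorem coordT_row₁ (hD : frameDet r₀ r₁ r₂ r₃ ≠ 0) : coordT r₀ r₁ r₂ r₃ r₁ = 1 := by
  rw [coordT_apply, div_self hD]

/-- `coordT r₂ = 0`. [folklore] -/
theorem coordT_row₂ : coordT r₀ r₁ r₂ r₃ r₂ = 0 := by
  rw [coordT_apply, frameDet_self₁₂, zero_div]

/-- `coordT r₃ = 0`. [folklore] -/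
theorem coordT_row₃ : coordT r₀ r₁ r₂ r₃ r₃ = 0 := by
  rw [coordT_apply, frameDet_self₁₃, zero_div]

/-- `coordC r₀ = 0`. [folklore] -/
theorem coordC_row₀ : coordC r₀ r₁ r₂ r₃ r₀ = 0 :=
  Complex.ext (by rw [coordC_apply_re, frameDet_self₀₂, zero_div]; rfl)
    (by rw [coordC_apply_im, frameDet_self₀₃, zero_div]; rfl)

/-- `coordC r₁ = 0`. [folklore] -/
theorem coordC_row₁ : coordC r₀ r₁ r₂ r₃ r₁ = 0 :=
  Complex.ext (by rw [coordC_apply_re, frameDet_self₁₂, zero_div]; rfl)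
    (by rw [coordC_apply_im, frameDet_self₁₃, zero_div]; rfl)

/-- `coordC r₂ = 1`. [folklore] -/
theorem coordC_row₂ (hD : frameDet r₀ r₁ r₂ r₃ ≠ 0) : coordC r₀ r₁ r₂ r₃ r₂ = 1 :=
  Complex.ext (by rw [coordC_apply_re, div_self hD]; rfl)
    (by rw [coordC_apply_im, frameDet_self₂₃, zero_div]; rfl)

/-- `coordC r₃ = i`. [folklore] -/
theorem coordC_row₃ (hD : frameDet r₀ r₁ r₂ r₃ ≠ 0) : coordC r₀ r₁ r₂ r₃ r₃ = Complex.I :=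
  Complex.ext (by rw [coordC_apply_re, frameDet_self₂₃]; simp)
    (by rw [coordC_apply_im, div_self hD]; rfl)

/-- **The determinant of two vectors in the `coordC`-plane**: for `u v : ℝ⁴`,
`cdet (coordC u) (coordC v) = [r₀, r₁, u, v] / [r₀, r₁, r₂, r₃]` (the Plücker relation).
Here `cdet p q = Re p · Im q - Im p · Re q`. [folklore] -/
theorem cdet_coordC (hD : frameDet r₀ r₁ r₂ r₃ ≠ 0) (u v : 𝔼 4) :
    (coordC r₀ r₁ r₂ r₃ u).re * (coordC r₀ r₁ r₂ r₃ v).im -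
        (coordC r₀ r₁ r₂ r₃ u).im * (coordC r₀ r₁ r₂ r₃ v).re =
      frameDet r₀ r₁ u v / frameDet r₀ r₁ r₂ r₃ := by
  simp only [coordC_apply_re, coordC_apply_im]
  have h := frameDet_pluecker r₀ r₁ r₂ r₃ u v
  rw [div_mul_div_comm, div_mul_div_comm, ← sub_div, div_eq_div_iff (mul_ne_zero hD hD) hD]
  linear_combination (-(frameDet r₀ r₁ r₂ r₃)) * h

end Coordinates


attribute [local instance] fact_finrank_euclideanSpace_two fact_finrank_euclideanSpace_four

/-! ### The fibre of a tubular neighbourhood over the base point, as a map `ℝ² → ℝ⁴` -/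

namespace Knot.TubularNbhd

variable {K : Knot} (ν : Knot.TubularNbhd K)

/-- The fibre of the tubular neighbourhood `ν` over `x₀ = circlePoint 0`, as a map
`ℝ² → ℝ⁴ ⊇ 𝕊³`: `w ↦ ν (x₀, w)`. [folklore] -/
def fibreMap (w : 𝔼 2) : 𝔼 4 := ((ν (circlePoint 0, w) : 𝕊 3) : 𝔼 4)

/-- Unfolding of `fibreMap`. [folklore] -/
theorem fibreMap_apply (w : 𝔼 2) : ν.fibreMap w = ((ν (circlePoint 0, w) : 𝕊 3) : 𝔼 4) := rfl

/-- The fibre map is smooth. [folklore] -/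
theorem contDiff_fibreMap : ContDiff ℝ ∞ ν.fibreMap := by
  rw [← contMDiff_iff_contDiff]
  exact contMDiff_coe_sphere.comp (ν.contMDiff.comp (contMDiff_const.prodMk contMDiff_id))

/-- The fibre map is continuous. [folklore] -/
@[continuity, fun_prop]
theorem continuous_fibreMap : Continuous ν.fibreMap := ν.contDiff_fibreMap.continuous

/-- The fibre map at `0` is the base point `p = K (x₀)` of the knot. [folklore] -/
theorem fibreMap_zero : ν.fibreMap 0 = K.curve 0 := by
  rw [fibreMap_apply, coe_apply_zero, SphereEmbedding.curve_apply]

/-- The fibre map takes values in the unit sphere. [folklore] -/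
@[simp] theorem norm_fibreMap (w : 𝔼 2) : ‖ν.fibreMap w‖ = 1 := by
  rw [fibreMap_apply, norm_eq_of_mem_sphere]

/-- The differential of the fibre map at `0`, `ℝ² →L ℝ⁴`. [folklore] -/
def fibreDeriv : 𝔼 2 →L[ℝ] 𝔼 4 := fderiv ℝ ν.fibreMap 0

/-- The fibre map has derivative `fibreDeriv` at `0`. [folklore] -/
theorem hasFDerivAt_fibreMap : HasFDerivAt ν.fibreMap ν.fibreDeriv 0 :=
  ((ν.contDiff_fibreMap.differentiable (by simp)) 0).hasFDerivAt

/-- The **normal vectors** `∂ν/∂w₁`, `∂ν/∂w₂` of the tubular neighbourhood at the base point: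
the images of the standard basis of `ℝ²` under the differential of the fibre map at `0` (the
last two rows of the determinant `det_pos` at `(θ, w) = (0, 0)`). [folklore] -/
def normalVec (i : Fin 2) : 𝔼 4 := ν.fibreDeriv (EuclideanSpace.single i 1)

/-- `EuclideanSpace.single i s = s • single i 1`. [folklore] -/
theorem single_eq_smul_single_one (i : Fin 2) (s : ℝ) :
    (EuclideanSpace.single i s : 𝔼 2) = s • EuclideanSpace.single i 1 := by
  ext j
  by_cases h : j = i
  · subst h; simp
  · simp [h]

/-- The rows `deriv (s ↦ ν (x₀, 0 + s eᵢ)) 0` of `det_pos` at `(0, 0)` are the normal vectors.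
[folklore] -/
theorem deriv_slice_eq_normalVec (i : Fin 2) :
    deriv (fun s : ℝ => ((ν (circlePoint 0, (0 : 𝔼 2) + EuclideanSpace.single i s) : 𝕊 3) : 𝔼 4))
      0 = ν.normalVec i := by
  have hg : HasDerivAt (fun s : ℝ => (0 : 𝔼 2) + EuclideanSpace.single i s)
      (EuclideanSpace.single i 1) 0 := by
    have h := ((hasDerivAt_id (0 : ℝ)).smul_const (EuclideanSpace.single i (1 : ℝ))).const_add
      (0 : 𝔼 2)
    simp only [one_smul] at h
    refine h.congr_of_eventuallyEq (Filter.Eventually.of_forall fun s => ?_)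
    simp only [id, single_eq_smul_single_one i s]
  have h0 : (0 : 𝔼 2) + EuclideanSpace.single i (0 : ℝ) = 0 := by
    rw [zero_add, single_eq_smul_single_one, zero_smul]
  have hf : HasFDerivAt ν.fibreMap ν.fibreDeriv ((0 : 𝔼 2) + EuclideanSpace.single i 0) := by
    rw [h0]
    exact ν.hasFDerivAt_fibreMap
  exact (hf.comp_hasDerivAt (0 : ℝ) hg).deriv

/-- The row `deriv (t ↦ ν (circlePoint t, 0)) 0` of `det_pos` at `(0, 0)` is the velocity
`T = γ'(0)` of the knot (`ν (x, 0) = K x`). [folklore] -/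
theorem deriv_core_eq_tangent :
    deriv (fun t : ℝ => ((ν (circlePoint t, 0) : 𝕊 3) : 𝔼 4)) 0 = K.tangent 0 := by
  have e : (fun t : ℝ => ((ν (circlePoint t, 0) : 𝕊 3) : 𝔼 4)) = K.curve := by
    funext t
    rw [coe_apply_zero, SphereEmbedding.curve_apply]
  rw [e, SphereEmbedding.tangent_apply]

/-- **The orientation convention at the base point**: the frame
`(p, T, ∂ν/∂w₁, ∂ν/∂w₂)`, `p = γ(0)`, `T = γ'(0)`, has positive determinant (the field `det_pos`
of `Knot.TubularNbhd` at `(θ, w) = (0, 0)`). [folklore] -/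
theorem frameDet_normalVec_pos :
    0 < frameDet (K.curve 0) (K.tangent 0) (ν.normalVec 0) (ν.normalVec 1) := by
  have h := ν.det_pos 0 0
  simp only [toFun_eq_coe] at h
  rw [frameDet_eq, ← ν.deriv_core_eq_tangent, ← ν.deriv_slice_eq_normalVec 0,
    ← ν.deriv_slice_eq_normalVec 1, SphereEmbedding.curve_apply, ← ν.coe_apply_zero]
  exact h


/-- A point of the punctured fibre over `x₀`, as a point of the knot complement. [folklore] -/
def fibrePoint (w : 𝔼 2) (hw : w ≠ 0) : K.complement :=
  ⟨ν (circlePoint 0, w), ν.apply_mem_compl_range hw⟩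

/-- Coordinates of `fibrePoint`. [folklore] -/
@[simp] theorem coe_fibrePoint (w : 𝔼 2) (hw : w ≠ 0) :
    ((ν.fibrePoint w hw : 𝕊 3) : 𝔼 4) = ν.fibreMap w := rfl

/-- The **meridian of radius `r`**: the loop `t ↦ ν (x₀, r e^{2π i t})` in the knot complement,
based at `ν (x₀, (r, 0))` (`ν.meridian` is the case `r = ½`). [folklore] -/
def smallMeridian (r : ℝ) (hr : r ≠ 0) :
    Path (ν.fibrePoint (r • ((circlePoint 0 : 𝕊 1) : 𝔼 2)) (smul_circlePoint_ne_zero hr 0))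
      (ν.fibrePoint (r • ((circlePoint 0 : 𝕊 1) : 𝔼 2)) (smul_circlePoint_ne_zero hr 0)) where
  toFun t := ν.fibrePoint (r • ((circlePoint (2 * Real.pi * t) : 𝕊 1) : 𝔼 2))
    (smul_circlePoint_ne_zero hr _)
  continuous_toFun := by
    refine Continuous.subtype_mk (Continuous.subtype_mk ?_ _) _
    change Continuous fun t : I => ((ν (circlePoint 0,
      r • ((circlePoint (2 * Real.pi * t) : 𝕊 1) : 𝔼 2)) : 𝕊 3) : 𝔼 4)
    fun_prop
  source' := by
    apply Subtype.ext; apply Subtype.ext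
    simp
  target' := by
    apply Subtype.ext; apply Subtype.ext
    simp only [coe_fibrePoint, Set.Icc.coe_one, mul_one]
    rw [← zero_add (2 * Real.pi), circlePoint_add_two_pi]

/-- Values of the small meridian in `ℝ⁴`. [folklore] -/
theorem coe_smallMeridian (r : ℝ) (hr : r ≠ 0) (t : I) :
    (((ν.smallMeridian r hr t : K.complement) : 𝕊 3) : 𝔼 4) =
      ν.fibreMap (r • ((circlePoint (2 * Real.pi * t) : 𝕊 1) : 𝔼 2)) := rfl

/-- **Radial free homotopy**: the meridian `ν.meridian` (radius `½`) and the meridian of radius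
`r > 0` are conjugate loops of the knot complement (shrink the radius inside the punctured fibre).
[folklore] -/
theorem loopConj_meridian_smallMeridian (r : ℝ) (hr : 0 < r) :
    LoopConj ν.meridian (ν.smallMeridian r hr.ne') := by
  -- radii `ρ_s = (1 - s)/2 + s r > 0`
  have hρ : ∀ s : I, (1 - (s : ℝ)) / 2 + s * r ≠ 0 := fun s => by
    have h0 : (0 : ℝ) ≤ s := s.2.1
    have h1 : (s : ℝ) ≤ 1 := s.2.2
    have : 0 < (1 - (s : ℝ)) / 2 + s * r := by
      rcases eq_or_lt_of_le h0 with h | h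
      · rw [← h]; norm_num
      · nlinarith
    exact this.ne'
  let F : C(I × I, K.complement) :=
    ⟨fun x => ν.fibrePoint (((1 - (x.1 : ℝ)) / 2 + x.1 * r) •
        ((circlePoint (2 * Real.pi * x.2) : 𝕊 1) : 𝔼 2)) (smul_circlePoint_ne_zero (hρ x.1) _), by
      refine Continuous.subtype_mk (Continuous.subtype_mk ?_ _) _
      change Continuous fun x : I × I => ((ν (circlePoint 0, (((1 - (x.1 : ℝ)) / 2 + x.1 * r) •
        ((circlePoint (2 * Real.pi * x.2) : 𝕊 1) : 𝔼 2))) : 𝕊 3) : 𝔼 4)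
      fun_prop⟩
  refine LoopConj.of_square F (fun s => ?_) _ _ (fun t => ?_) (fun t => ?_)
  · apply Subtype.ext; apply Subtype.ext
    change ν.fibreMap _ = ν.fibreMap _
    simp only [Set.Icc.coe_zero, Set.Icc.coe_one, mul_zero, mul_one]
    rw [← zero_add (2 * Real.pi), circlePoint_add_two_pi]
  · apply Subtype.ext; apply Subtype.ext
    change ((ν.meridian t : 𝕊 3) : 𝔼 4) = ν.fibreMap _
    rw [coe_meridian_apply, fibreMap_apply]
    simp only [Set.Icc.coe_zero, sub_zero, zero_mul, add_zero, one_div]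
  · apply Subtype.ext; apply Subtype.ext
    change ν.fibreMap _ = ν.fibreMap _
    simp only [Set.Icc.coe_one, sub_self, zero_div, one_mul, zero_add]

end Knot.TubularNbhd

/-! ### `ℂ ≅ ℝ²` as a continuous linear map -/

/-- The identification `ℂ → ℝ²`, `z ↦ (Re z, Im z)`, as a continuous real-linear map; pointwise it
is `PlaneComplex.ofC`. [folklore] -/
def ofCL : ℂ →L[ℝ] 𝔼 2 :=
  (Complex.orthonormalBasisOneI.repr.toContinuousLinearEquiv : ℂ ≃L[ℝ] 𝔼 2)

/-- `ofCL` is `PlaneComplex.ofC`. [folklore] -/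
theorem ofCL_apply (z : ℂ) : ofCL z = PlaneComplex.ofC z := by
  ext i
  change (Complex.orthonormalBasisOneI.repr z) i = PlaneComplex.ofC z i
  rw [Complex.orthonormalBasisOneI_repr_apply]
  fin_cases i <;> rfl

/-- `ofCL 1 = e₀`. [folklore] -/
theorem ofCL_one : ofCL 1 = EuclideanSpace.single 0 1 := by
  ext i
  rw [ofCL_apply]
  fin_cases i <;> simp [PlaneComplex.ofC]

/-- `ofCL i = e₁`. [folklore] -/
theorem ofCL_I : ofCL Complex.I = EuclideanSpace.single 1 1 := by
  ext i
  rw [ofCL_apply]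
  fin_cases i <;> simp [PlaneComplex.ofC]

/-- `‖ofCL z‖ = ‖z‖`. [folklore] -/
@[simp] theorem norm_ofCL (z : ℂ) : ‖ofCL z‖ = ‖z‖ :=
  Complex.orthonormalBasisOneI.repr.norm_map z


/-! ### The frame of a second tubular neighbourhood at the base point -/

namespace Knot.TubularNbhd

variable {K : Knot} (ν ν' : Knot.TubularNbhd K)

/-- The **tangential coordinate** with respect to the frame `(p, T, ∂ν'/∂w₁, ∂ν'/∂w₂)` of `ℝ⁴`
determined by the knot and the tubular neighbourhood `ν'` at the base point. [folklore] -/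
def tanCoord : 𝔼 4 →L[ℝ] ℝ :=
  LinearMap.toContinuousLinearMap
    (coordT (K.curve 0) (K.tangent 0) (ν'.normalVec 0) (ν'.normalVec 1))

/-- The **normal coordinates** (as a complex number) with respect to the frame
`(p, T, ∂ν'/∂w₁, ∂ν'/∂w₂)`. [folklore] -/
def norCoord : 𝔼 4 →L[ℝ] ℂ :=
  LinearMap.toContinuousLinearMap
    (coordC (K.curve 0) (K.tangent 0) (ν'.normalVec 0) (ν'.normalVec 1))

/-- Formula for the tangential coordinate. [folklore] -/
theorem tanCoord_apply (v : 𝔼 4) : ν'.tanCoord v =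
    frameDet (K.curve 0) v (ν'.normalVec 0) (ν'.normalVec 1) /
      frameDet (K.curve 0) (K.tangent 0) (ν'.normalVec 0) (ν'.normalVec 1) := rfl

/-- The normal coordinates are `coordC`. [folklore] -/
theorem norCoord_apply (v : 𝔼 4) : ν'.norCoord v =
    coordC (K.curve 0) (K.tangent 0) (ν'.normalVec 0) (ν'.normalVec 1) v := rfl

/-- `Λ p = 0`. [folklore] -/
@[simp] theorem tanCoord_curve : ν'.tanCoord (K.curve 0) = 0 := coordT_row₀

/-- `Λ T = 1`. [folklore] -/
@[simp] theorem tanCoord_tangent : ν'.tanCoord (K.tangent 0) = 1 :=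
  coordT_row₁ ν'.frameDet_normalVec_pos.ne'

/-- `Λ (∂₁ν') = 0`. [folklore] -/
@[simp] theorem tanCoord_normalVec_zero : ν'.tanCoord (ν'.normalVec 0) = 0 := coordT_row₂

/-- `Λ (∂₂ν') = 0`. [folklore] -/
@[simp] theorem tanCoord_normalVec_one : ν'.tanCoord (ν'.normalVec 1) = 0 := coordT_row₃

/-- `Φ p = 0`. [folklore] -/
@[simp] theorem norCoord_curve : ν'.norCoord (K.curve 0) = 0 := coordC_row₀

/-- `Φ T = 0`. [folklore] -/
@[simp] theorem norCoord_tangent : ν'.norCoord (K.tangent 0) = 0 := coordC_row₁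

/-- `Φ (∂₁ν') = 1`. [folklore] -/
@[simp] theorem norCoord_normalVec_zero : ν'.norCoord (ν'.normalVec 0) = 1 :=
  coordC_row₂ ν'.frameDet_normalVec_pos.ne'

/-- `Φ (∂₂ν') = i`. [folklore] -/
@[simp] theorem norCoord_normalVec_one : ν'.norCoord (ν'.normalVec 1) = Complex.I :=
  coordC_row₃ ν'.frameDet_normalVec_pos.ne'

/-- The **linearised normal map** of `ν` read in the frame of `ν'`: the real-linear map
`ℂ → ℂ`, `z ↦ norCoord_{ν'} (dν_{(x₀,0)} (z))`, whose determinant is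
`[p, T, ∂₁ν, ∂₂ν] / [p, T, ∂₁ν', ∂₂ν'] > 0` by the two orientation conventions. [folklore] -/
def normalMap : ℂ →L[ℝ] ℂ := (ν'.norCoord.comp ν.fibreDeriv).comp ofCL

/-- Values of the linearised normal map. [folklore] -/
theorem normalMap_apply (z : ℂ) : normalMap ν ν' z = ν'.norCoord (ν.fibreDeriv (ofCL z)) := rfl

/-- `normalMap 1 = norCoord (∂₁ν)`. [folklore] -/
theorem normalMap_one : normalMap ν ν' 1 = ν'.norCoord (ν.normalVec 0) := by
  rw [normalMap_apply, ofCL_one]; rfl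

/-- `normalMap i = norCoord (∂₂ν)`. [folklore] -/
theorem normalMap_I : normalMap ν ν' Complex.I = ν'.norCoord (ν.normalVec 1) := by
  rw [normalMap_apply, ofCL_I]; rfl

/-- **The linearised normal map preserves the orientation**: its determinant
`Re M(1) Im M(i) - Im M(1) Re M(i) = [p, T, ∂₁ν, ∂₂ν] / [p, T, ∂₁ν', ∂₂ν']` is positive, both
tubular neighbourhoods satisfying `det_pos`. [folklore] -/
theorem det_normalMap_pos :
    0 < (normalMap ν ν' 1).re * (normalMap ν ν' Complex.I).im -
      (normalMap ν ν' 1).im * (normalMap ν ν' Complex.I).re := by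
  rw [normalMap_one, normalMap_I, norCoord_apply, norCoord_apply,
    cdet_coordC ν'.frameDet_normalVec_pos.ne']
  exact div_pos ν.frameDet_normalVec_pos ν'.frameDet_normalVec_pos

/-- For `ν' = ν` the linearised normal map is the identity. [folklore] -/
theorem normalMap_self (z : ℂ) : normalMap ν ν z = z := by
  rw [normalMap_apply, ← Complex.re_add_im z, map_add]
  have h1 : ofCL (z.re : ℂ) = z.re • EuclideanSpace.single 0 1 := by
    rw [show (z.re : ℂ) = z.re • (1 : ℂ) by rw [Complex.real_smul, mul_one], map_smul, ofCL_one]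
  have h2 : ofCL ((z.im : ℂ) * Complex.I) = z.im • EuclideanSpace.single 1 1 := by
    rw [← Complex.real_smul, map_smul, ofCL_I]
  rw [h1, h2, map_add, map_smul, map_smul, map_add, map_smul, map_smul]
  change z.re • ν.norCoord (ν.normalVec 0) + z.im • ν.norCoord (ν.normalVec 1) = _
  rw [norCoord_normalVec_zero, norCoord_normalVec_one, Complex.real_smul, Complex.real_smul,
    mul_one]

end Knot.TubularNbhd

/-! ### Real-linear maps of `ℂ` -/

/-- A real-linear map of `ℂ` in terms of its values at `1` and `i`. [folklore] -/
theorem clm_apply_eq_re_im (D : ℂ →L[ℝ] ℂ) (z : ℂ) :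
    D z = (z.re : ℂ) * D 1 + (z.im : ℂ) * D Complex.I := by
  conv_lhs => rw [← Complex.re_add_im z]
  rw [map_add]
  have h1 : D (z.re : ℂ) = (z.re : ℂ) * D 1 := by
    have e : (z.re : ℂ) = (z.re : ℝ) • (1 : ℂ) := by rw [Complex.real_smul, mul_one]
    conv_lhs => rw [e]
    rw [map_smul, Complex.real_smul]
  have h2 : D ((z.im : ℂ) * Complex.I) = (z.im : ℂ) * D Complex.I := by
    rw [← Complex.real_smul, map_smul, Complex.real_smul]
  rw [h1, h2]

/-- A real-linear map of `ℂ` with nonzero determinant is bounded below. [folklore] -/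
theorem exists_mul_norm_le_of_det_ne_zero (D : ℂ →L[ℝ] ℂ)
    (h : (D 1).re * (D Complex.I).im - (D 1).im * (D Complex.I).re ≠ 0) :
    ∃ c > 0, ∀ z, c * ‖z‖ ≤ ‖D z‖ := by
  have hinj : Function.Injective D := by
    intro z w hzw
    have h0 : D (z - w) = 0 := by rw [map_sub, hzw, sub_self]
    rw [clm_apply_eq_re_im] at h0
    set x := (z - w).re with hx
    set y := (z - w).im with hy
    have e1 : x * (D 1).re + y * (D Complex.I).re = 0 := by simpa using congrArg Complex.re h0
    have e2 : x * (D 1).im + y * (D Complex.I).im = 0 := by simpa using congrArg Complex.im h0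
    have ex : x * ((D 1).re * (D Complex.I).im - (D 1).im * (D Complex.I).re) = 0 := by
      linear_combination (D Complex.I).im * e1 - (D Complex.I).re * e2
    have ey : y * ((D 1).re * (D Complex.I).im - (D 1).im * (D Complex.I).re) = 0 := by
      linear_combination (D 1).re * e2 - (D 1).im * e1
    have hx0 : x = 0 := (mul_eq_zero.1 ex).resolve_right h
    have hy0 : y = 0 := (mul_eq_zero.1 ey).resolve_right h
    rw [hx, Complex.sub_re, sub_eq_zero] at hx0
    rw [hy, Complex.sub_im, sub_eq_zero] at hy0
    exact Complex.ext hx0 hy0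
  have hbij : Function.Bijective (D : ℂ →ₗ[ℝ] ℂ) :=
    ⟨hinj, LinearMap.injective_iff_surjective.1 hinj⟩
  let e : ℂ ≃L[ℝ] ℂ := (LinearEquiv.ofBijective (D : ℂ →ₗ[ℝ] ℂ) hbij).toContinuousLinearEquiv
  have he : ∀ z, e z = D z := fun z => by
    change (LinearEquiv.ofBijective (D : ℂ →ₗ[ℝ] ℂ) hbij) z = D z
    rfl
  obtain ⟨c, hc, hcz⟩ := antilipschitzWith_iff_exists_mul_le_norm.1 ⟨_, e.antilipschitz⟩
  exact ⟨c, hc, fun z => by rw [← he]; exact hcz z⟩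

/-! ### The knot near the base point lies in a thin cone around its tangent -/

namespace SphereEmbedding

variable (K : Knot)

/-- A point of `S¹` near `circlePoint 0` is `circlePoint θ` with `θ` small (the angle
`θ = arg (x₀ + i x₁)` depends continuously on `x` near `(1, 0)`). [folklore] -/
theorem exists_eq_circlePoint_of_dist_lt {ζ : ℝ} (hζ : 0 < ζ) :
    ∃ ζ' > 0, ∀ x : 𝕊 1, dist x (circlePoint 0) < ζ' → ∃ θ : ℝ, |θ| < ζ ∧ x = circlePoint θ := by
  have h1 : toC ((circlePoint 0 : 𝕊 1) : 𝔼 2) = 1 := by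
    rw [← one_smul ℝ ((circlePoint 0 : 𝕊 1) : 𝔼 2), PlaneComplex.toC_polar]
    simp
  have hcont : ContinuousAt (fun x : 𝕊 1 => Complex.arg (toC (x : 𝔼 2))) (circlePoint 0) := by
    refine ContinuousAt.comp (g := Complex.arg) ?_
      ((PlaneComplex.continuous_toC.comp continuous_subtype_val).continuousAt)
    change ContinuousAt Complex.arg (toC ((circlePoint 0 : 𝕊 1) : 𝔼 2))
    rw [h1]
    exact Complex.continuousAt_arg (by simp)
  obtain ⟨ζ', hζ', h⟩ := Metric.continuousAt_iff.1 hcont ζ hζ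
  refine ⟨ζ', hζ', fun x hx => ⟨Complex.arg (toC (x : 𝔼 2)), ?_, ?_⟩⟩
  · have := h hx
    rwa [h1, Complex.arg_one, Real.dist_eq, sub_zero] at this
  · have hpol := Complex.norm_mul_exp_arg_mul_I (toC (x : 𝔼 2))
    rw [norm_toC_sphere, Complex.ofReal_one, one_mul] at hpol
    apply Subtype.ext
    ext i
    fin_cases i
    · have := congrArg Complex.re hpol
      rw [Complex.exp_ofReal_mul_I_re, toC_re] at this
      simpa [circlePoint_apply_zero] using this.symm
    · have := congrArg Complex.im hpol
      rw [Complex.exp_ofReal_mul_I_im, toC_im] at this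
      simpa [circlePoint_apply_one] using this.symm

/-- Points of `S¹` with nearby images under a knot are nearby (`K` is an embedding). [folklore] -/
theorem exists_dist_lt_of_dist_apply_lt (x₀ : 𝕊 1) {ζ' : ℝ} (hζ' : 0 < ζ') :
    ∃ d > 0, ∀ x : 𝕊 1, dist (K x) (K x₀) < d → dist x x₀ < ζ' := by
  have hn : (𝓝 x₀ : Filter (𝕊 1)) = Filter.comap K (𝓝 (K x₀)) :=
    K.isEmbedding.nhds_eq_comap x₀
  have hmem : Metric.ball x₀ ζ' ∈ Filter.comap K (𝓝 (K x₀)) := hn ▸ Metric.ball_mem_nhds x₀ hζ'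
  obtain ⟨t, ht, hsub⟩ := Filter.mem_comap.1 hmem
  obtain ⟨d, hd, hball⟩ := Metric.mem_nhds_iff.1 ht
  exact ⟨d, hd, fun x hx => hsub (hball hx)⟩

/-- Distances of knot points in `𝕊³` are distances in `ℝ⁴`. [folklore] -/
theorem dist_apply_eq_norm_sub (x y : 𝕊 1) :
    dist (K x) (K y) = ‖((K x : 𝕊 3) : 𝔼 4) - ((K y : 𝕊 3) : 𝔼 4)‖ := by
  rw [Subtype.dist_eq, dist_eq_norm]

/-- **Cone lemma.** Let `Λ : ℝ⁴ → ℝ` and `Φ : ℝ⁴ → ℂ` be continuous linear maps with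
`Λ p = 0`, `Λ T = 1`, `Φ p = 0`, `Φ T = 0` for the base point `p = γ(0)` and velocity `T = γ'(0)`
of the knot. Then for every `η > 0` the knot near `p` lies in the cone `‖Φ y‖ ≤ η |Λ y|`:
`γ(θ) = p + θ T + o(θ)`, and points of the knot near `p` are `γ(θ)` with `θ` small.
[folklore] -/
theorem exists_cone (Λ : 𝔼 4 →L[ℝ] ℝ) (Φ : 𝔼 4 →L[ℝ] ℂ) (hΛp : Λ (K.curve 0) = 0)
    (hΛT : Λ (K.tangent 0) = 1) (hΦp : Φ (K.curve 0) = 0) (hΦT : Φ (K.tangent 0) = 0) {η : ℝ}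
    (hη : 0 < η) :
    ∃ d > 0, ∀ x : 𝕊 1, ‖((K x : 𝕊 3) : 𝔼 4) - K.curve 0‖ < d →
      ‖Φ ((K x : 𝕊 3) : 𝔼 4)‖ ≤ η * |Λ ((K x : 𝕊 3) : 𝔼 4)| := by
  -- the little-o constant
  set ε : ℝ := min (1 / (2 * (‖Λ‖ + 1))) (η / (2 * (‖Φ‖ + 1))) with hε
  have hε0 : 0 < ε := lt_min (by positivity) (by positivity)
  have hεΛ : ‖Λ‖ * ε ≤ 1 / 2 := by
    have h1 : ε ≤ 1 / (2 * (‖Λ‖ + 1)) := min_le_left _ _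
    have h2 : ‖Λ‖ * (1 / (2 * (‖Λ‖ + 1))) ≤ 1 / 2 := by
      rw [mul_one_div, div_le_div_iff₀ (by positivity) (by positivity)]
      nlinarith [norm_nonneg Λ]
    exact (mul_le_mul_of_nonneg_left h1 (norm_nonneg _)).trans h2
  have hεΦ : ‖Φ‖ * ε ≤ η / 2 := by
    have h1 : ε ≤ η / (2 * (‖Φ‖ + 1)) := min_le_right _ _
    have h2 : ‖Φ‖ * (η / (2 * (‖Φ‖ + 1))) ≤ η / 2 := by
      rw [mul_div_assoc', div_le_div_iff₀ (by positivity) (by positivity)]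
      nlinarith [norm_nonneg Φ, hη]
    exact (mul_le_mul_of_nonneg_left h1 (norm_nonneg _)).trans h2
  -- differentiability of the knot at `0`
  have hder := (hasDerivAt_iff_isLittleO_nhds_zero.1 (K.hasDerivAt_curve 0)).def hε0
  simp only [zero_add] at hder
  obtain ⟨ζ, hζ, hζθ⟩ := Metric.eventually_nhds_iff.1 hder
  obtain ⟨ζ', hζ', hang⟩ := exists_eq_circlePoint_of_dist_lt hζ
  obtain ⟨d, hd, hemb⟩ := K.exists_dist_lt_of_dist_apply_lt (circlePoint 0) hζ'
  refine ⟨d, hd, fun x hx => ?_⟩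
  have hx' : dist (K x) (K (circlePoint 0)) < d := by
    rwa [dist_apply_eq_norm_sub, ← curve_apply]
  obtain ⟨θ, hθ, rfl⟩ := hang x (hemb x hx')
  have hR : ‖K.curve θ - K.curve 0 - θ • K.tangent 0‖ ≤ ε * ‖θ‖ :=
    hζθ (by rwa [dist_zero_right, Real.norm_eq_abs])
  set R := K.curve θ - K.curve 0 - θ • K.tangent 0 with hRdef
  have hcurve : K.curve θ = K.curve 0 + θ • K.tangent 0 + R := by rw [hRdef]; abel
  rw [← curve_apply, hcurve, map_add, map_add, map_smul, hΦp, hΦT, smul_zero, zero_add, zero_add,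
    map_add, map_add, map_smul, hΛp, hΛT, zero_add, smul_eq_mul, mul_one]
  have h1 : ‖Φ R‖ ≤ ‖Φ‖ * ε * |θ| := by
    calc ‖Φ R‖ ≤ ‖Φ‖ * ‖R‖ := Φ.le_opNorm R
      _ ≤ ‖Φ‖ * (ε * |θ|) := by
          rw [← Real.norm_eq_abs]; exact mul_le_mul_of_nonneg_left hR (norm_nonneg _)
      _ = _ := by ring
  have h2 : |Λ R| ≤ ‖Λ‖ * ε * |θ| := by
    calc |Λ R| = ‖Λ R‖ := (Real.norm_eq_abs _).symm
      _ ≤ ‖Λ‖ * ‖R‖ := Λ.le_opNorm R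
      _ ≤ ‖Λ‖ * (ε * |θ|) := by
          rw [← Real.norm_eq_abs]; exact mul_le_mul_of_nonneg_left hR (norm_nonneg _)
      _ = _ := by ring
  have h3 : |θ| / 2 ≤ |θ + Λ R| := by
    have := abs_sub_abs_le_abs_sub θ (-(Λ R))
    rw [abs_neg, sub_neg_eq_add] at this
    nlinarith [abs_nonneg θ]
  calc ‖Φ R‖ ≤ ‖Φ‖ * ε * |θ| := h1
    _ ≤ η / 2 * |θ| := mul_le_mul_of_nonneg_right hεΦ (abs_nonneg _)
    _ = η * (|θ| / 2) := by ring
    _ ≤ η * |θ + Λ R| := mul_le_mul_of_nonneg_left h3 hη.le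

end SphereEmbedding


/-! ### Normalisation to the sphere and the avoidance criterion -/

section Normalize

/-- Radial projection to the unit sphere moves a point near a unit vector `p` by at most twice
its distance to `p`. [folklore] -/
theorem norm_inv_smul_sub_le {p y : 𝔼 4} (hp : ‖p‖ = 1) (hy : y ≠ 0) :
    ‖‖y‖⁻¹ • y - p‖ ≤ 2 * ‖y - p‖ := by
  have hy' : ‖y‖ ≠ 0 := norm_ne_zero_iff.2 hy
  have h1 : ‖‖y‖⁻¹ • y - y‖ = |1 - ‖y‖| := by
    rw [show ‖y‖⁻¹ • y - y = (‖y‖⁻¹ - 1) • y by rw [sub_smul, one_smul], norm_smul,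
      Real.norm_eq_abs, ← abs_of_pos (norm_pos_iff.2 hy), ← abs_mul, abs_of_pos (norm_pos_iff.2 hy)]
    congr 1
    field_simp
  have h2 : |1 - ‖y‖| ≤ ‖y - p‖ := by
    rw [← hp]
    have := abs_norm_sub_norm_le p y
    rwa [← norm_sub_rev y p] at this
  calc ‖‖y‖⁻¹ • y - p‖ ≤ ‖‖y‖⁻¹ • y - y‖ + ‖y - p‖ := norm_sub_le_norm_sub_add_norm_sub _ _ _
    _ ≤ ‖y - p‖ + ‖y - p‖ := by rw [h1]; exact add_le_add_left h2 _
    _ = 2 * ‖y - p‖ := by ring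

/-- A point at distance `< 1` from a unit vector is nonzero. [folklore] -/
theorem ne_zero_of_norm_sub_lt_one {p y : 𝔼 4} (hp : ‖p‖ = 1) (h : ‖y - p‖ < 1) : y ≠ 0 := by
  rintro rfl
  rw [zero_sub, norm_neg, hp] at h
  exact lt_irrefl _ h

variable {K : Knot}

/-- A unit vector of `ℝ⁴` missing the knot, as a point of the knot complement. [folklore] -/
def Knot.complPt (v : 𝔼 4) (h1 : ‖v‖ = 1) (h2 : ∀ x : 𝕊 1, ((K x : 𝕊 3) : 𝔼 4) ≠ v) :
    K.complement :=
  ⟨⟨v, mem_sphere_zero_iff_norm.2 h1⟩, fun ⟨x, hx⟩ => h2 x (congrArg Subtype.val hx)⟩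

/-- Coordinates of `complPt`. [folklore] -/
@[simp] theorem Knot.coe_complPt (v : 𝔼 4) (h1 : ‖v‖ = 1)
    (h2 : ∀ x : 𝕊 1, ((K x : 𝕊 3) : 𝔼 4) ≠ v) : ((K.complPt v h1 h2 : 𝕊 3) : 𝔼 4) = v := rfl

/-- **Avoidance criterion.** If the knot lies in the cone `‖Φ‖ ≤ η |Λ|` within distance `d` of
`p = γ(0)`, then the radial projection of any point `y` with `2 ‖y - p‖ < d` in the open
anti-cone `η |Λ y| < ‖Φ y‖` misses the knot (both conditions are invariant under positive
rescaling). [folklore] -/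
theorem SphereEmbedding.forall_coe_ne_inv_smul (K : Knot) {Λ : 𝔼 4 →L[ℝ] ℝ} {Φ : 𝔼 4 →L[ℝ] ℂ}
    {η d : ℝ} (hcone : ∀ x : 𝕊 1, ‖((K x : 𝕊 3) : 𝔼 4) - K.curve 0‖ < d →
      ‖Φ ((K x : 𝕊 3) : 𝔼 4)‖ ≤ η * |Λ ((K x : 𝕊 3) : 𝔼 4)|)
    {y : 𝔼 4} (hy : y ≠ 0) (hyd : 2 * ‖y - K.curve 0‖ < d) (hanti : η * |Λ y| < ‖Φ y‖)
    (x : 𝕊 1) : ((K x : 𝕊 3) : 𝔼 4) ≠ ‖y‖⁻¹ • y := by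
  intro h
  have hc : 0 < ‖y‖⁻¹ := inv_pos.2 (norm_pos_iff.2 hy)
  have h1 := hcone x (by
    rw [h]
    exact (norm_inv_smul_sub_le (K.norm_curve 0) hy).trans_lt hyd)
  rw [h, map_smul, map_smul, norm_smul, smul_eq_mul, abs_mul, Real.norm_eq_abs, abs_of_pos hc,
    mul_left_comm] at h1
  exact absurd (lt_of_mul_lt_mul_left (h1.trans_lt' (by nlinarith [hanti, hc])) hc.le)
    (lt_irrefl _)

end Normalize


/-! ### Circle points and the normal lift -/

/-- The point `r e^{2π i t}` of `ℂ`. [folklore] -/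
def circ (r t : ℝ) : ℂ := (r : ℂ) * Complex.exp ((2 * Real.pi * t : ℝ) * Complex.I)

/-- `‖circ r t‖ = r` for `r ≥ 0`. [folklore] -/
theorem norm_circ {r : ℝ} (hr : 0 ≤ r) (t : ℝ) : ‖circ r t‖ = r := by
  rw [circ, norm_mul, Complex.norm_exp_ofReal_mul_I, mul_one, Complex.norm_real, Real.norm_eq_abs,
    abs_of_nonneg hr]

/-- `circ r t ≠ 0` for `r ≠ 0`. [folklore] -/
theorem circ_ne_zero {r : ℝ} (hr : r ≠ 0) (t : ℝ) : circ r t ≠ 0 :=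
  mul_ne_zero (Complex.ofReal_ne_zero.2 hr) (Complex.exp_ne_zero _)

/-- The circle closes up: `circ r 1 = circ r 0`. [folklore] -/
theorem circ_one (r : ℝ) : circ r 1 = circ r 0 := by
  simp only [circ, mul_one, mul_zero]
  rw [show ((2 * Real.pi : ℝ) : ℂ) * Complex.I = 2 * Real.pi * Complex.I by push_cast; ring,
    Complex.exp_two_pi_mul_I]
  simp

/-- `circ` is continuous in both variables. [folklore] -/
@[fun_prop] theorem continuous_circ : Continuous fun x : ℝ × ℝ => circ x.1 x.2 := by
  unfold circ; fun_prop

/-- `ofCL (r e^{2π i t}) = r (cos 2πt, sin 2πt)`. [folklore] -/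
theorem ofCL_circ (r t : ℝ) :
    ofCL (circ r t) = r • ((circlePoint (2 * Real.pi * t) : 𝕊 1) : 𝔼 2) := by
  rw [ofCL_apply, circ, PlaneComplex.ofC_polar]

namespace Knot.TubularNbhd

variable {K : Knot} (ν' : Knot.TubularNbhd K)

/-- The **normal lift** `L z = Re z · ∂₁ν' + Im z · ∂₂ν' ∈ ℝ⁴` of the frame of `ν'`: a right
inverse of the normal coordinates, killed by the tangential coordinate. [folklore] -/
def normalLift (z : ℂ) : 𝔼 4 := z.re • ν'.normalVec 0 + z.im • ν'.normalVec 1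

/-- The normal lift is continuous. [folklore] -/
@[fun_prop] theorem continuous_normalLift : Continuous ν'.normalLift := by
  unfold normalLift; fun_prop

/-- `norCoord (L z) = z`. [folklore] -/
@[simp] theorem norCoord_normalLift (z : ℂ) : ν'.norCoord (ν'.normalLift z) = z := by
  rw [normalLift, map_add, map_smul, map_smul, norCoord_normalVec_zero, norCoord_normalVec_one,
    Complex.real_smul, Complex.real_smul, mul_one, Complex.re_add_im]

/-- `tanCoord (L z) = 0`. [folklore] -/
@[simp] theorem tanCoord_normalLift (z : ℂ) : ν'.tanCoord (ν'.normalLift z) = 0 := by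
  rw [normalLift, map_add, map_smul, map_smul, tanCoord_normalVec_zero, tanCoord_normalVec_one,
    smul_zero, smul_zero, add_zero]

/-- `‖L z‖ ≤ (‖∂₁ν'‖ + ‖∂₂ν'‖) ‖z‖`. [folklore] -/
theorem norm_normalLift_le (z : ℂ) :
    ‖ν'.normalLift z‖ ≤ (‖ν'.normalVec 0‖ + ‖ν'.normalVec 1‖) * ‖z‖ := by
  rw [normalLift]
  calc ‖z.re • ν'.normalVec 0 + z.im • ν'.normalVec 1‖
        ≤ ‖z.re • ν'.normalVec 0‖ + ‖z.im • ν'.normalVec 1‖ := norm_add_le _ _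
    _ = |z.re| * ‖ν'.normalVec 0‖ + |z.im| * ‖ν'.normalVec 1‖ := by
        rw [norm_smul, norm_smul, Real.norm_eq_abs, Real.norm_eq_abs]
    _ ≤ ‖z‖ * ‖ν'.normalVec 0‖ + ‖z‖ * ‖ν'.normalVec 1‖ := by
        gcongr
        · exact Complex.abs_re_le_norm z
        · exact Complex.abs_im_le_norm z
    _ = _ := by ring

/-- The point `p + L (A (r e^{2π i t}))` of the **linear loop** attached to a real-linear map
`A : ℂ → ℂ`. [folklore] -/
def linPt (A : ℂ →L[ℝ] ℂ) (r t : ℝ) : 𝔼 4 := K.curve 0 + ν'.normalLift (A (circ r t))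

/-- The linear loop closes up. [folklore] -/
theorem linPt_one (A : ℂ →L[ℝ] ℂ) (r : ℝ) : ν'.linPt A r 1 = ν'.linPt A r 0 := by
  rw [linPt, linPt, circ_one]

/-- Normal coordinates of the linear loop. [folklore] -/
@[simp] theorem norCoord_linPt (A : ℂ →L[ℝ] ℂ) (r t : ℝ) :
    ν'.norCoord (ν'.linPt A r t) = A (circ r t) := by
  rw [linPt, map_add, norCoord_curve, norCoord_normalLift, zero_add]

/-- Tangential coordinate of the linear loop. [folklore] -/
@[simp] theorem tanCoord_linPt (A : ℂ →L[ℝ] ℂ) (r t : ℝ) : ν'.tanCoord (ν'.linPt A r t) = 0 := by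
  rw [linPt, map_add, tanCoord_curve, tanCoord_normalLift, zero_add]

/-- Distance of the linear loop to the base point. [folklore] -/
theorem norm_linPt_sub_le (A : ℂ →L[ℝ] ℂ) {r : ℝ} (hr : 0 ≤ r) (t : ℝ) :
    ‖ν'.linPt A r t - K.curve 0‖ ≤ (‖ν'.normalVec 0‖ + ‖ν'.normalVec 1‖) * ‖A‖ * r := by
  rw [linPt, add_sub_cancel_left]
  calc ‖ν'.normalLift (A (circ r t))‖ ≤ (‖ν'.normalVec 0‖ + ‖ν'.normalVec 1‖) * ‖A (circ r t)‖ :=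
        ν'.norm_normalLift_le _
    _ ≤ (‖ν'.normalVec 0‖ + ‖ν'.normalVec 1‖) * (‖A‖ * r) := by
        gcongr
        calc ‖A (circ r t)‖ ≤ ‖A‖ * ‖circ r t‖ := A.le_opNorm _
          _ = ‖A‖ * r := by rw [norm_circ hr t]
    _ = _ := by ring

/-- **The linear loop** `t ↦ (p + L (A (r e^{2π i t}))) / ‖⋯‖` in the knot complement, given the
two facts that make it live there (unit norm after normalisation, and missing the knot;
`linLoop_good`). [folklore] -/
def linLoop (A : ℂ →L[ℝ] ℂ) (r : ℝ) (h1 : ∀ t : ℝ, ‖‖ν'.linPt A r t‖⁻¹ • ν'.linPt A r t‖ = 1)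
    (h2 : ∀ (t : ℝ) (x : 𝕊 1), ((K x : 𝕊 3) : 𝔼 4) ≠ ‖ν'.linPt A r t‖⁻¹ • ν'.linPt A r t) :
    Path (K.complPt _ (h1 0) (h2 0)) (K.complPt _ (h1 0) (h2 0)) where
  toFun t := K.complPt _ (h1 t) (h2 t)
  continuous_toFun := by
    refine Continuous.subtype_mk (Continuous.subtype_mk ?_ _) _
    have hc : Continuous fun t : I => ν'.linPt A r t := by unfold linPt; fun_prop
    have hne : ∀ t : I, ‖ν'.linPt A r t‖ ≠ 0 := fun t h0 => by
      have := h1 t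
      rw [h0, inv_zero, zero_smul, norm_zero] at this
      exact zero_ne_one this
    exact ((continuous_norm.comp hc).inv₀ hne).smul hc
  source' := rfl
  target' := by
    apply Subtype.ext; apply Subtype.ext
    simp only [Knot.coe_complPt, Set.Icc.coe_one, linPt_one]

/-- Values of the linear loop in `ℝ⁴`. [folklore] -/
theorem coe_linLoop (A : ℂ →L[ℝ] ℂ) (r : ℝ)
    (h1 : ∀ t : ℝ, ‖‖ν'.linPt A r t‖⁻¹ • ν'.linPt A r t‖ = 1)
    (h2 : ∀ (t : ℝ) (x : 𝕊 1), ((K x : 𝕊 3) : 𝔼 4) ≠ ‖ν'.linPt A r t‖⁻¹ • ν'.linPt A r t) (t : I) :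
    (((ν'.linLoop A r h1 h2 t : K.complement) : 𝕊 3) : 𝔼 4) =
      ‖ν'.linPt A r t‖⁻¹ • ν'.linPt A r t := rfl

/-- **The linear loops live in the knot complement for small radius**: if `det A ≠ 0`, for
all sufficiently small `r > 0` the points `p + L (A (r e^{2π i t}))` are nonzero after
normalisation and their radial projections to `𝕊³` miss the knot (they lie in the anti-cone
`0 = |Λ| < ‖Φ‖` near `p`, while the knot lies in the cone `‖Φ‖ ≤ |Λ|`). [folklore] -/
theorem linLoop_good (A : ℂ →L[ℝ] ℂ)
    (hA : (A 1).re * (A Complex.I).im - (A 1).im * (A Complex.I).re ≠ 0) :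
    ∃ r₀ > 0, ∀ r, 0 < r → r < r₀ →
      (∀ t : ℝ, ‖‖ν'.linPt A r t‖⁻¹ • ν'.linPt A r t‖ = 1) ∧
        ∀ (t : ℝ) (x : 𝕊 1), ((K x : 𝕊 3) : 𝔼 4) ≠ ‖ν'.linPt A r t‖⁻¹ • ν'.linPt A r t := by
  obtain ⟨d, hd, hcone⟩ := K.exists_cone ν'.tanCoord ν'.norCoord ν'.tanCoord_curve
    ν'.tanCoord_tangent ν'.norCoord_curve ν'.norCoord_tangent one_pos
  obtain ⟨c, hc, hcz⟩ := exists_mul_norm_le_of_det_ne_zero A hA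
  set C : ℝ := (‖ν'.normalVec 0‖ + ‖ν'.normalVec 1‖) * ‖A‖ with hC
  have hC0 : 0 ≤ C := by positivity
  refine ⟨min (1 / (C + 1)) (d / (2 * (C + 1))), lt_min (by positivity) (by positivity),
    fun r hr hrlt => ?_⟩
  have hr1 : C * r < 1 := by
    have h := hrlt.trans_le (min_le_left _ _)
    rw [lt_div_iff₀ (by positivity)] at h
    nlinarith
  have hr2 : 2 * (C * r) < d := by
    have h := hrlt.trans_le (min_le_right _ _)
    rw [lt_div_iff₀ (by positivity)] at h
    nlinarith
  have hdist : ∀ t : ℝ, ‖ν'.linPt A r t - K.curve 0‖ ≤ C * r := fun t =>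
    ν'.norm_linPt_sub_le A hr.le t
  have hne : ∀ t : ℝ, ν'.linPt A r t ≠ 0 := fun t =>
    ne_zero_of_norm_sub_lt_one (K.norm_curve 0) ((hdist t).trans_lt hr1)
  refine ⟨fun t => norm_smul_inv_norm (hne t), fun t x => ?_⟩
  refine K.forall_coe_ne_inv_smul hcone (hne t) ?_ ?_ x
  · calc 2 * ‖ν'.linPt A r t - K.curve 0‖ ≤ 2 * (C * r) := by gcongr; exact hdist t
      _ < d := hr2
  · rw [tanCoord_linPt, abs_zero, mul_zero, norCoord_linPt, norm_pos_iff]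
    intro h0
    have := hcz (circ r t)
    rw [h0, norm_zero, norm_circ hr.le] at this
    nlinarith


end Knot.TubularNbhd

/-! ### Deforming a positively oriented real-linear map of `ℂ` to the identity -/

section DefMap

variable (A : ℂ →L[ℝ] ℂ)

/-- The **deformation** `A_s`, `s ∈ [0, 1]`, of the real-linear map `A` (`A z = Re z · P + Im z ·
Q`,
`P = A 1`, `Q = A i`) to the identity through maps with no nonzero kernel:
`A_s z = e^{(1-s) log P} (Re z + Im z · q_s)`, `q_s = (1 - s) Q/P + s i` (the complex factor
deforms `P` to `1` avoiding `0`, and `q_s` stays in the upper half plane when `Im (Q/P) > 0`,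
i.e. when `A` preserves the orientation). [folklore] -/
def defMap (s : ℝ) (z : ℂ) : ℂ :=
  Complex.exp ((1 - s : ℝ) * Complex.log (A 1)) *
    (z.re + z.im * ((1 - s : ℝ) * (A Complex.I / A 1) + (s : ℝ) * Complex.I))

/-- The deformation is jointly continuous. [folklore] -/
theorem continuous_defMap : Continuous fun x : ℝ × ℂ => defMap A x.1 x.2 := by
  unfold defMap
  have hre : Continuous fun x : ℝ × ℂ => (x.2.re : ℂ) :=
    Complex.continuous_ofReal.comp (Complex.continuous_re.comp continuous_snd)
  have him : Continuous fun x : ℝ × ℂ => (x.2.im : ℂ) :=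
    Complex.continuous_ofReal.comp (Complex.continuous_im.comp continuous_snd)
  fun_prop

/-- At `s = 0` the deformation is `A` (`P ≠ 0`). [folklore] -/
theorem defMap_zero (hP : A 1 ≠ 0) (z : ℂ) : defMap A 0 z = A z := by
  rw [defMap, clm_apply_eq_re_im A z]
  simp only [sub_zero, Complex.ofReal_one, one_mul, Complex.ofReal_zero, zero_mul, add_zero,
    Complex.exp_log hP]
  field_simp

/-- At `s = 1` the deformation is the identity. [folklore] -/
theorem defMap_one (z : ℂ) : defMap A 1 z = z := by
  rw [defMap]
  simp only [sub_self, Complex.ofReal_zero, zero_mul, Complex.exp_zero, one_mul, Complex.ofReal_one,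
    zero_add, Complex.re_add_im]

/-- The deformation has no nonzero kernel for `s ∈ [0, 1]` when `Im (Q/P) > 0`. [folklore] -/
theorem defMap_ne_zero (hq : 0 < (A Complex.I / A 1).im) {s : ℝ} (hs0 : 0 ≤ s) (hs1 : s ≤ 1)
    {z : ℂ} (hz : z ≠ 0) : defMap A s z ≠ 0 := by
  rw [defMap]
  refine mul_ne_zero (Complex.exp_ne_zero _) fun h0 => hz ?_
  have hqs : 0 < ((1 - s : ℝ) * (A Complex.I / A 1) + (s : ℝ) * Complex.I).im := by
    simp only [Complex.add_im, Complex.mul_im, Complex.ofReal_re, Complex.ofReal_im, zero_mul,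
      add_zero, Complex.I_im, mul_one, Complex.I_re, mul_zero]
    rcases eq_or_lt_of_le hs1 with h | h
    · rw [h]; norm_num
    · nlinarith
  have him : z.im * ((1 - s : ℝ) * (A Complex.I / A 1) + (s : ℝ) * Complex.I).im = 0 := by
    have := congrArg Complex.im h0
    simpa using this
  have hzim : z.im = 0 := (mul_eq_zero.1 him).resolve_right hqs.ne'
  have hzre : z.re = 0 := by
    have := congrArg Complex.re h0
    simp [hzim] at this
    exact this
  exact Complex.ext hzre hzim

/-- A uniform linear bound for the deformation, `s ∈ [0, 1]`. [folklore] -/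
theorem norm_defMap_le {s : ℝ} (hs0 : 0 ≤ s) (hs1 : s ≤ 1) (z : ℂ) :
    ‖defMap A s z‖ ≤ Real.exp |(Complex.log (A 1)).re| * (2 + ‖A Complex.I / A 1‖) * ‖z‖ := by
  rw [defMap, norm_mul, Complex.norm_exp]
  have h1 : Real.exp (((1 - s : ℝ) : ℂ) * Complex.log (A 1)).re ≤
      Real.exp |(Complex.log (A 1)).re| := by
    apply Real.exp_le_exp.2
    rw [Complex.re_ofReal_mul]
    calc (1 - s) * (Complex.log (A 1)).re ≤ |(1 - s) * (Complex.log (A 1)).re| := le_abs_self _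
      _ = |1 - s| * |(Complex.log (A 1)).re| := abs_mul _ _
      _ ≤ 1 * |(Complex.log (A 1)).re| := by
          gcongr
          rw [abs_of_nonneg (by linarith)]
          linarith
      _ = _ := one_mul _
  have h2 : ‖(z.re : ℂ) + z.im * ((1 - s : ℝ) * (A Complex.I / A 1) + (s : ℝ) * Complex.I)‖ ≤
      (2 + ‖A Complex.I / A 1‖) * ‖z‖ := by
    have hq : ‖((1 - s : ℝ) : ℂ) * (A Complex.I / A 1) + (s : ℝ) * Complex.I‖ ≤
        ‖A Complex.I / A 1‖ + 1 := by
      calc _ ≤ ‖((1 - s : ℝ) : ℂ) * (A Complex.I / A 1)‖ + ‖((s : ℝ) : ℂ) * Complex.I‖ :=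
            norm_add_le _ _
        _ = |1 - s| * ‖A Complex.I / A 1‖ + |s| := by
            rw [norm_mul, norm_mul, Complex.norm_real, Complex.norm_real, Complex.norm_I, mul_one,
              Real.norm_eq_abs, Real.norm_eq_abs]
        _ ≤ 1 * ‖A Complex.I / A 1‖ + 1 := by
            gcongr
            · rw [abs_of_nonneg (by linarith)]; linarith
            · rw [abs_of_nonneg hs0]; exact hs1
        _ = _ := by rw [one_mul]
    calc _ ≤ ‖(z.re : ℂ)‖ +
          ‖(z.im : ℂ) * ((1 - s : ℝ) * (A Complex.I / A 1) + (s : ℝ) * Complex.I)‖ :=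
          norm_add_le _ _
      _ = |z.re| + |z.im| * ‖((1 - s : ℝ) : ℂ) * (A Complex.I / A 1) + (s : ℝ) * Complex.I‖ := by
          rw [norm_mul, Complex.norm_real, Complex.norm_real, Real.norm_eq_abs, Real.norm_eq_abs]
      _ ≤ ‖z‖ + ‖z‖ * (‖A Complex.I / A 1‖ + 1) := by
          gcongr
          · exact Complex.abs_re_le_norm z
          · exact Complex.abs_im_le_norm z
      _ = (2 + ‖A Complex.I / A 1‖) * ‖z‖ := by ring
  calc _ ≤ Real.exp |(Complex.log (A 1)).re| * ((2 + ‖A Complex.I / A 1‖) * ‖z‖) :=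
        mul_le_mul h1 h2 (norm_nonneg _) (Real.exp_pos _).le
    _ = _ := by ring

end DefMap

namespace Knot.TubularNbhd

variable {K : Knot} (ν' : Knot.TubularNbhd K)

/-- **Linear loops of positively oriented maps are conjugate to the round linear loop.** For a
real-linear `A : ℂ → ℂ` of positive determinant and all small `r > 0`, the loops
`t ↦ (p + L (A (r e^{2π i t}))) / ‖⋯‖` and `t ↦ (p + L (r e^{2π i t})) / ‖⋯‖` of the knot
complement are conjugate: the deformation `A_s` (`defMap`) gives a free homotopy through loops
in the anti-cone `Λ = 0 < ‖Φ‖` near `p`, which misses the knot. [folklore] -/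
theorem loopConj_linLoop_id (A : ℂ →L[ℝ] ℂ)
    (hA : 0 < (A 1).re * (A Complex.I).im - (A 1).im * (A Complex.I).re) :
    ∃ r₀ > 0, ∀ r, 0 < r → r < r₀ → ∀ h1 h2 h1' h2',
      LoopConj (ν'.linLoop A r h1 h2) (ν'.linLoop (ContinuousLinearMap.id ℝ ℂ) r h1' h2') := by
  -- data of `A`
  have hP : A 1 ≠ 0 := by
    intro h; rw [h] at hA; simp at hA
  have hq : 0 < (A Complex.I / A 1).im := by
    rw [Complex.div_im, div_sub_div_same]
    refine div_pos ?_ (Complex.normSq_pos.2 hP)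
    linarith [hA]
  obtain ⟨d, hd, hcone⟩ := K.exists_cone ν'.tanCoord ν'.norCoord ν'.tanCoord_curve
    ν'.tanCoord_tangent ν'.norCoord_curve ν'.norCoord_tangent one_pos
  set C : ℝ := (‖ν'.normalVec 0‖ + ‖ν'.normalVec 1‖) *
    (Real.exp |(Complex.log (A 1)).re| * (2 + ‖A Complex.I / A 1‖)) with hC
  have hC0 : 0 ≤ C := by positivity
  refine ⟨min (1 / (C + 1)) (d / (2 * (C + 1))), lt_min (by positivity) (by positivity),
    fun r hr hrlt h1 h2 h1' h2' => ?_⟩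
  have hr1 : C * r < 1 := by
    have h := hrlt.trans_le (min_le_left _ _)
    rw [lt_div_iff₀ (by positivity)] at h
    nlinarith
  have hr2 : 2 * (C * r) < d := by
    have h := hrlt.trans_le (min_le_right _ _)
    rw [lt_div_iff₀ (by positivity)] at h
    nlinarith
  -- the homotopy in `ℝ⁴`
  set y : I × I → 𝔼 4 := fun x => K.curve 0 + ν'.normalLift (defMap A x.1 (circ r x.2)) with hy
  have hdist : ∀ x : I × I, ‖y x - K.curve 0‖ ≤ C * r := fun x => by
    rw [hy]
    dsimp only
    rw [add_sub_cancel_left]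
    calc _ ≤ (‖ν'.normalVec 0‖ + ‖ν'.normalVec 1‖) * ‖defMap A x.1 (circ r x.2)‖ :=
          ν'.norm_normalLift_le _
      _ ≤ (‖ν'.normalVec 0‖ + ‖ν'.normalVec 1‖) *
            (Real.exp |(Complex.log (A 1)).re| * (2 + ‖A Complex.I / A 1‖) * ‖circ r x.2‖) := by
          gcongr
          exact norm_defMap_le A x.1.2.1 x.1.2.2 _
      _ = C * r := by rw [norm_circ hr.le]; ring
  have hne : ∀ x, y x ≠ 0 := fun x =>
    ne_zero_of_norm_sub_lt_one (K.norm_curve 0) ((hdist x).trans_lt hr1)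
  have hΛ : ∀ x, ν'.tanCoord (y x) = 0 := fun x => by
    rw [hy]; dsimp only; rw [map_add, tanCoord_curve, tanCoord_normalLift, zero_add]
  have hΦ : ∀ x, ν'.norCoord (y x) = defMap A x.1 (circ r x.2) := fun x => by
    rw [hy]; dsimp only; rw [map_add, norCoord_curve, norCoord_normalLift, zero_add]
  have hmiss : ∀ (x : I × I) (u : 𝕊 1), ((K u : 𝕊 3) : 𝔼 4) ≠ ‖y x‖⁻¹ • y x := fun x u => by
    refine K.forall_coe_ne_inv_smul hcone (hne x) ?_ ?_ u
    · calc 2 * ‖y x - K.curve 0‖ ≤ 2 * (C * r) := by gcongr; exact hdist x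
        _ < d := hr2
    · rw [hΛ, abs_zero, mul_zero, hΦ, norm_pos_iff]
      exact defMap_ne_zero A hq x.1.2.1 x.1.2.2 (circ_ne_zero hr.ne' _)
  have hyc : Continuous y := by
    rw [hy]
    refine continuous_const.add (ν'.continuous_normalLift.comp ?_)
    exact (continuous_defMap A).comp ((continuous_subtype_val.comp continuous_fst).prodMk
      (continuous_circ.comp (continuous_const.prodMk (continuous_subtype_val.comp continuous_snd))))
  let F : C(I × I, K.complement) :=
    ⟨fun x => K.complPt (‖y x‖⁻¹ • y x) (norm_smul_inv_norm (hne x)) (hmiss x), by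
      refine Continuous.subtype_mk (Continuous.subtype_mk ?_ _) _
      exact ((continuous_norm.comp hyc).inv₀ fun x => norm_ne_zero_iff.2 (hne x)).smul hyc⟩
  have hF : ∀ x, (((F x : K.complement) : 𝕊 3) : 𝔼 4) = ‖y x‖⁻¹ • y x := fun x => rfl
  refine LoopConj.of_square F (fun s => ?_) _ _ (fun t => ?_) (fun t => ?_)
  · apply Subtype.ext; apply Subtype.ext
    rw [hF, hF, hy]
    simp only [Set.Icc.coe_zero, Set.Icc.coe_one, circ_one]
  · apply Subtype.ext; apply Subtype.ext
    rw [hF, coe_linLoop, hy]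
    simp only [Set.Icc.coe_zero, defMap_zero A hP]
    rfl
  · apply Subtype.ext; apply Subtype.ext
    rw [hF, coe_linLoop, hy]
    simp only [Set.Icc.coe_one, defMap_one]
    rfl


variable (ν : Knot.TubularNbhd K)
set_option maxHeartbeats 400000 in -- buildfix (bf3-g26): 160k/180k FAIL, 200k PASS at accept time; line-neutral budget line
/-- **The small meridians of `ν` are conjugate to the linear loop of its linearised normal map.**
For all small `r > 0`, the meridian `t ↦ ν (x₀, r e^{2π i t})` of `ν` and the linear loop of
`M = normalMap ν ν'` (read in the frame of `ν'`) are conjugate loops of `S³ ∖ K`: the straight-line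
homotopy `(1 - s) ν(x₀, r e^{2πit}) + s (p + L (M (r e^{2πit})))`, radially projected to `𝕊³`,
stays in the anti-cone `η |Λ| < ‖Φ‖` near `p` (first-order Taylor expansion of the fibre map:
its normal coordinate is `M (r e^{2πit}) + o(r)`, bounded below by `m r / 2`, its tangential
coordinate is `O(r)`), hence misses the knot (cone lemma). [folklore] -/
theorem loopConj_smallMeridian_linLoop :
    ∃ r₀ > 0, ∀ r (hr : 0 < r), r < r₀ → ∀ h1 h2,
      LoopConj (ν.smallMeridian r hr.ne') (ν'.linLoop (normalMap ν ν') r h1 h2) := by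
  -- notation
  set M := normalMap ν ν' with hM
  set Φ := ν'.norCoord with hΦ
  set Λ := ν'.tanCoord with hΛ
  set D := ν.fibreDeriv with hD
  set CL : ℝ := ‖ν'.normalVec 0‖ + ‖ν'.normalVec 1‖ with hCL
  -- `M` is bounded below
  obtain ⟨m, hm, hmz⟩ := exists_mul_norm_le_of_det_ne_zero M (det_normalMap_pos ν ν').ne'
  -- Taylor constant
  set ε : ℝ := m / (2 * (‖Φ‖ + 1)) with hε
  have hε0 : 0 < ε := by positivity
  have hεΦ : ‖Φ‖ * ε ≤ m / 2 := by
    rw [hε, mul_div_assoc', div_le_div_iff₀ (by positivity) (by positivity)]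
    nlinarith [norm_nonneg Φ]
  have hlo := (hasFDerivAt_iff_isLittleO_nhds_zero.1 ν.hasFDerivAt_fibreMap).def hε0
  simp only [zero_add, fibreMap_zero] at hlo
  obtain ⟨ζ, hζ, hζw⟩ := Metric.eventually_nhds_iff.1 hlo
  -- cone constant
  set C₂ : ℝ := ‖Λ‖ * (‖D‖ + ε) with hC₂
  have hC₂0 : 0 ≤ C₂ := by positivity
  set η : ℝ := m / (2 * (C₂ + 1)) with hη
  have hη0 : 0 < η := by positivity
  have hηC : η * C₂ < m / 2 := by
    rw [hη, div_mul_eq_mul_div, div_lt_div_iff₀ (by positivity) (by positivity)]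
    nlinarith
  obtain ⟨d, hd, hcone⟩ := K.exists_cone Λ Φ ν'.tanCoord_curve ν'.tanCoord_tangent
    ν'.norCoord_curve ν'.norCoord_tangent hη0
  -- radius
  set C₁ : ℝ := ‖D‖ + ε + CL * ‖M‖ with hC₁
  have hC₁0 : 0 ≤ C₁ := by positivity
  refine ⟨min ζ (min (1 / (C₁ + 1)) (d / (2 * (C₁ + 1)))),
    lt_min hζ (lt_min (by positivity) (by positivity)), fun r hr hrlt h1 h2 => ?_⟩
  have hrζ : r < ζ := hrlt.trans_le (min_le_left _ _)
  have hr1 : C₁ * r < 1 := by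
    have h := hrlt.trans_le ((min_le_right _ _).trans (min_le_left _ _))
    rw [lt_div_iff₀ (by positivity)] at h
    nlinarith
  have hr2 : 2 * (C₁ * r) < d := by
    have h := hrlt.trans_le ((min_le_right _ _).trans (min_le_right _ _))
    rw [lt_div_iff₀ (by positivity)] at h
    nlinarith
  -- the fibre parameter and the Taylor remainder
  set w : ℝ → 𝔼 2 := fun t => ofCL (circ r t) with hw
  have hwn : ∀ t, ‖w t‖ = r := fun t => by rw [hw]; dsimp only; rw [norm_ofCL, norm_circ hr.le]
  set R : ℝ → 𝔼 4 := fun t => ν.fibreMap (w t) - K.curve 0 - D (w t) with hR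
  have hRn : ∀ t, ‖R t‖ ≤ ε * r := fun t => by
    have := hζw (y := w t) (by rw [dist_zero_right, hwn]; exact hrζ)
    rwa [hwn] at this
  have hfib : ∀ t, ν.fibreMap (w t) = K.curve 0 + D (w t) + R t := fun t => by
    rw [hR]; dsimp only; abel
  have hΦD : ∀ t, Φ (D (w t)) = M (circ r t) := fun t => rfl
  -- the straight-line homotopy in `ℝ⁴`
  set y : I × I → 𝔼 4 := fun x =>
    (1 - (x.1 : ℝ)) • ν.fibreMap (w x.2) + (x.1 : ℝ) • ν'.linPt M r x.2 with hy
  have hs01 : ∀ s : I, (0 : ℝ) ≤ s ∧ (s : ℝ) ≤ 1 := fun s => ⟨s.2.1, s.2.2⟩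
  have hysub : ∀ x : I × I, y x - K.curve 0 =
      (1 - (x.1 : ℝ)) • (D (w x.2) + R x.2) + (x.1 : ℝ) • (ν'.linPt M r x.2 - K.curve 0) :=
      fun x => by
    rw [hy]; dsimp only; rw [hfib]
    simp only [smul_add, smul_sub, sub_smul, one_smul]
    abel
  have hdist : ∀ x : I × I, ‖y x - K.curve 0‖ ≤ C₁ * r := fun x => by
    obtain ⟨h0, h1'⟩ := hs01 x.1
    rw [hysub]
    calc _ ≤ ‖(1 - (x.1 : ℝ)) • (D (w x.2) + R x.2)‖ +
          ‖(x.1 : ℝ) • (ν'.linPt M r x.2 - K.curve 0)‖ := norm_add_le _ _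
      _ = (1 - (x.1 : ℝ)) * ‖D (w x.2) + R x.2‖ + (x.1 : ℝ) * ‖ν'.linPt M r x.2 - K.curve 0‖ := by
          rw [norm_smul, norm_smul, Real.norm_eq_abs, Real.norm_eq_abs, abs_of_nonneg (by linarith),
            abs_of_nonneg h0]
      _ ≤ 1 * ((‖D‖ + ε) * r) + 1 * (CL * ‖M‖ * r) := by
          gcongr
          · linarith
          · calc ‖D (w x.2) + R x.2‖ ≤ ‖D (w x.2)‖ + ‖R x.2‖ := norm_add_le _ _
              _ ≤ ‖D‖ * r + ε * r := by
                  gcongr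
                  · calc ‖D (w x.2)‖ ≤ ‖D‖ * ‖w x.2‖ := D.le_opNorm _
                      _ = ‖D‖ * r := by rw [hwn]
                  · exact hRn _
              _ = (‖D‖ + ε) * r := by ring
          · exact ν'.norm_linPt_sub_le M hr.le _
      _ = C₁ * r := by rw [hC₁]; ring
  have hne : ∀ x, y x ≠ 0 := fun x =>
    ne_zero_of_norm_sub_lt_one (K.norm_curve 0) ((hdist x).trans_lt hr1)
  -- normal coordinate: `Φ y = M (r e^{2πit}) + (1 - s) Φ R`
  have hΦy : ∀ x : I × I, Φ (y x) = M (circ r x.2) + (1 - (x.1 : ℝ)) • Φ (R x.2) := fun x => by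
    rw [hy]; dsimp only
    rw [map_add, map_smul, map_smul, hfib, map_add, map_add, hΦ, norCoord_curve, norCoord_linPt,
      ← hΦ, hΦD, zero_add, smul_add]
    rw [add_right_comm, ← add_smul, sub_add_cancel, one_smul]
  have hDR : ∀ t, ‖D (w t) + R t‖ ≤ (‖D‖ + ε) * r := fun t => by
    calc ‖D (w t) + R t‖ ≤ ‖D (w t)‖ + ‖R t‖ := norm_add_le _ _
      _ ≤ ‖D‖ * r + ε * r := by
          gcongr
          · calc ‖D (w t)‖ ≤ ‖D‖ * ‖w t‖ := D.le_opNorm _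
              _ = ‖D‖ * r := by rw [hwn]
          · exact hRn _
      _ = (‖D‖ + ε) * r := by ring
  have hΦy_ge : ∀ x : I × I, m / 2 * r ≤ ‖Φ (y x)‖ := fun x => by
    obtain ⟨h0, h1'⟩ := hs01 x.1
    rw [hΦy]
    have hA : m * r ≤ ‖M (circ r x.2)‖ := by
      have := hmz (circ r x.2); rwa [norm_circ hr.le] at this
    have hB : ‖(1 - (x.1 : ℝ)) • Φ (R x.2)‖ ≤ m / 2 * r := by
      rw [norm_smul, Real.norm_eq_abs, abs_of_nonneg (by linarith)]
      calc (1 - (x.1 : ℝ)) * ‖Φ (R x.2)‖ ≤ 1 * (‖Φ‖ * (ε * r)) := by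
            gcongr
            · linarith
            · exact (Φ.le_opNorm _).trans (mul_le_mul_of_nonneg_left (hRn _) (norm_nonneg _))
        _ = ‖Φ‖ * ε * r := by ring
        _ ≤ m / 2 * r := mul_le_mul_of_nonneg_right hεΦ hr.le
    have hC : ‖M (circ r x.2)‖ ≤ ‖M (circ r x.2) + (1 - (x.1 : ℝ)) • Φ (R x.2)‖ +
        ‖(1 - (x.1 : ℝ)) • Φ (R x.2)‖ := by
      have := norm_sub_le (M (circ r x.2) + (1 - (x.1 : ℝ)) • Φ (R x.2))
        ((1 - (x.1 : ℝ)) • Φ (R x.2))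
      rwa [add_sub_cancel_right] at this
    linarith
  -- tangential coordinate: `Λ y = (1 - s) Λ (D w + R) = O(r)`
  have hΛy : ∀ x : I × I, |Λ (y x)| ≤ C₂ * r := fun x => by
    obtain ⟨h0, h1'⟩ := hs01 x.1
    have e : Λ (y x) = (1 - (x.1 : ℝ)) * Λ (D (w x.2) + R x.2) := by
      have : y x = (1 - (x.1 : ℝ)) • ν.fibreMap (w x.2) + (x.1 : ℝ) • ν'.linPt M r x.2 := rfl
      rw [this, map_add, map_smul, map_smul, hΛ, tanCoord_linPt, ← hΛ, smul_zero, add_zero, hfib,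
        add_assoc, map_add, hΛ, tanCoord_curve, ← hΛ, zero_add, smul_eq_mul]
    rw [e, abs_mul, abs_of_nonneg (by linarith)]
    calc (1 - (x.1 : ℝ)) * |Λ (D (w x.2) + R x.2)| ≤ 1 * (‖Λ‖ * ((‖D‖ + ε) * r)) := by
          gcongr
          · linarith
          · rw [← Real.norm_eq_abs]
            exact (Λ.le_opNorm _).trans (mul_le_mul_of_nonneg_left (hDR _) (norm_nonneg _))
      _ = C₂ * r := by rw [hC₂]; ring
  -- the anti-cone condition and avoidance of the knot
  have hanti : ∀ x, η * |Λ (y x)| < ‖Φ (y x)‖ := fun x => by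
    calc η * |Λ (y x)| ≤ η * (C₂ * r) := mul_le_mul_of_nonneg_left (hΛy x) hη0.le
      _ = (η * C₂) * r := by ring
      _ < m / 2 * r := mul_lt_mul_of_pos_right hηC hr
      _ ≤ ‖Φ (y x)‖ := hΦy_ge x
  have hmiss : ∀ (x : I × I) (u : 𝕊 1), ((K u : 𝕊 3) : 𝔼 4) ≠ ‖y x‖⁻¹ • y x := fun x u => by
    refine K.forall_coe_ne_inv_smul hcone (hne x) ?_ (hanti x) u
    calc 2 * ‖y x - K.curve 0‖ ≤ 2 * (C₁ * r) := by gcongr; exact hdist x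
      _ < d := hr2
  -- the homotopy in the knot complement
  have hwc : Continuous fun t : ℝ => w t := by
    rw [hw]
    exact ofCL.continuous.comp (continuous_circ.comp (continuous_const.prodMk continuous_id))
  have hyc : Continuous y := by
    rw [hy]
    refine Continuous.add ?_ ?_
    · exact (continuous_const.sub (continuous_subtype_val.comp continuous_fst)).smul
        (ν.continuous_fibreMap.comp (hwc.comp (continuous_subtype_val.comp continuous_snd)))
    · refine (continuous_subtype_val.comp continuous_fst).smul ?_
      have : Continuous fun t : ℝ => ν'.linPt M r t := by unfold linPt; fun_prop
      exact this.comp (continuous_subtype_val.comp continuous_snd)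
  let F : C(I × I, K.complement) :=
    ⟨fun x => K.complPt (‖y x‖⁻¹ • y x) (norm_smul_inv_norm (hne x)) (hmiss x), by
      refine Continuous.subtype_mk (Continuous.subtype_mk ?_ _) _
      exact ((continuous_norm.comp hyc).inv₀ fun x => norm_ne_zero_iff.2 (hne x)).smul hyc⟩
  have hF : ∀ x, (((F x : K.complement) : 𝕊 3) : 𝔼 4) = ‖y x‖⁻¹ • y x := fun x => rfl
  have hy0 : ∀ t : I, y (0, t) = ν.fibreMap (w t) := fun t => by
    rw [hy]; dsimp only; rw [Set.Icc.coe_zero, sub_zero, one_smul, zero_smul, add_zero]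
  have hy1 : ∀ t : I, y (1, t) = ν'.linPt M r t := fun t => by
    rw [hy]; dsimp only; rw [Set.Icc.coe_one, sub_self, zero_smul, one_smul, zero_add]
  refine LoopConj.of_square F (fun s => ?_) _ _ (fun t => ?_) (fun t => ?_)
  · apply Subtype.ext; apply Subtype.ext
    have : y (s, 1) = y (s, 0) := by
      rw [hy]; dsimp only; rw [Set.Icc.coe_one, Set.Icc.coe_zero, hw]; dsimp only
      rw [circ_one, linPt_one]
    rw [hF, hF, this]
  · apply Subtype.ext; apply Subtype.ext
    rw [hF, hy0, coe_smallMeridian, norm_fibreMap, inv_one, one_smul, hw]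
    dsimp only
    rw [ofCL_circ]
  · apply Subtype.ext; apply Subtype.ext
    rw [hF, hy1, coe_linLoop]


/-- **Any two oriented meridians of a knot are conjugate loops of its complement.** For oriented
tubular neighbourhoods `ν`, `ν'` of `K` (both satisfying `det_pos`), the meridians `ν.meridian`
and `ν'.meridian` are conjugate in the fundamental groupoid of `S³ ∖ K` (i.e. freely homotopic):
`μ_ν ~ μ_ν^r ~ Y_M ~ Y_1 ~ Y_{M'} ~ μ_{ν'}^r ~ μ_{ν'}` for small `r`, by the radial homotopies,
the Taylor (straight-line) homotopies of `loopConj_smallMeridian_linLoop` for `ν` and `ν'` in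
the frame of `ν'`, and the deformations `loopConj_linLoop_id` of the positively oriented
linearised normal maps `M = normalMap ν ν'`, `M' = normalMap ν' ν'` to the identity.
[folklore] -/
theorem loopConj_meridian : LoopConj ν.meridian ν'.meridian := by
  have hM := det_normalMap_pos ν ν'
  have hM' := det_normalMap_pos ν' ν'
  have hid : (0 : ℝ) <
      ((ContinuousLinearMap.id ℝ ℂ) 1).re * ((ContinuousLinearMap.id ℝ ℂ) Complex.I).im -
        ((ContinuousLinearMap.id ℝ ℂ) 1).im * ((ContinuousLinearMap.id ℝ ℂ) Complex.I).re := by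
    simp
  obtain ⟨r₁, hr₁, hG⟩ := loopConj_smallMeridian_linLoop ν' ν
  obtain ⟨r₂, hr₂, hG'⟩ := loopConj_smallMeridian_linLoop ν' ν'
  obtain ⟨r₃, hr₃, hH⟩ := ν'.loopConj_linLoop_id (normalMap ν ν') hM
  obtain ⟨r₄, hr₄, hH'⟩ := ν'.loopConj_linLoop_id (normalMap ν' ν') hM'
  obtain ⟨r₅, hr₅, hgM⟩ := ν'.linLoop_good (normalMap ν ν') hM.ne'
  obtain ⟨r₆, hr₆, hgM'⟩ := ν'.linLoop_good (normalMap ν' ν') hM'.ne'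
  obtain ⟨r₇, hr₇, hg1⟩ := ν'.linLoop_good (ContinuousLinearMap.id ℝ ℂ) hid.ne'
  set r₀ := min r₁ (min r₂ (min r₃ (min r₄ (min r₅ (min r₆ r₇))))) with hr₀
  have hr₀pos : 0 < r₀ :=
    lt_min hr₁ (lt_min hr₂ (lt_min hr₃ (lt_min hr₄ (lt_min hr₅ (lt_min hr₆ hr₇)))))
  set r := r₀ / 2 with hrdef
  have hr : 0 < r := half_pos hr₀pos
  have hrr : r < r₀ := half_lt_self hr₀pos
  have h₁ : r < r₁ := hrr.trans_le (min_le_left _ _)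
  have h₂ : r < r₂ := hrr.trans_le ((min_le_right _ _).trans (min_le_left _ _))
  have h₃ : r < r₃ :=
    hrr.trans_le ((min_le_right _ _).trans ((min_le_right _ _).trans (min_le_left _ _)))
  have h₄ : r < r₄ := hrr.trans_le ((min_le_right _ _).trans ((min_le_right _ _).trans
    ((min_le_right _ _).trans (min_le_left _ _))))
  have h₅ : r < r₅ := hrr.trans_le ((min_le_right _ _).trans ((min_le_right _ _).trans
    ((min_le_right _ _).trans ((min_le_right _ _).trans (min_le_left _ _)))))
  have h₆ : r < r₆ := hrr.trans_le ((min_le_right _ _).trans ((min_le_right _ _).trans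
    ((min_le_right _ _).trans ((min_le_right _ _).trans ((min_le_right _ _).trans
      (min_le_left _ _))))))
  have h₇ : r < r₇ := hrr.trans_le ((min_le_right _ _).trans ((min_le_right _ _).trans
    ((min_le_right _ _).trans ((min_le_right _ _).trans ((min_le_right _ _).trans
      (min_le_right _ _))))))
  obtain ⟨a1, a2⟩ := hgM r hr h₅
  obtain ⟨b1, b2⟩ := hgM' r hr h₆
  obtain ⟨c1, c2⟩ := hg1 r hr h₇
  have e1 : LoopConj ν.meridian (ν.smallMeridian r hr.ne') :=
    ν.loopConj_meridian_smallMeridian r hr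
  have e2 := hG r hr h₁ a1 a2
  have e3 := hH r hr h₃ a1 a2 c1 c2
  have e4 := hH' r hr h₄ b1 b2 c1 c2
  have e5 := hG' r hr h₂ b1 b2
  have e6 : LoopConj ν'.meridian (ν'.smallMeridian r hr.ne') :=
    ν'.loopConj_meridian_smallMeridian r hr
  exact e1.trans (e2.trans (e3.trans (e4.symm.trans (e5.symm.trans e6.symm))))

/-- **Oriented meridians are homologous**: for oriented tubular neighbourhoods `ν`, `ν'` of
`K` and any path `δ` from `ν.basePoint` to `ν'.basePoint` in `S³ ∖ K`,
`[δ⁻¹ · μ_ν · δ]ᵃᵇ = [μ_{ν'}]ᵃᵇ` in `π₁(S³ ∖ K, ν'.basePoint)ᵃᵇ = H₁(S³ ∖ K)` — the orientation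
bookkeeping behind the oriented meridian generating `H₁(S³ ∖ K)` in Rolfsen (1976), §5.D.
[cite: Rolfsen1976, §5.D] -/
theorem abelianizationOf_conj_meridian_eq (δ : Path ν.basePoint ν'.basePoint) :
    Abelianization.of (FundamentalGroup.fromPath
        (Path.Homotopic.Quotient.mk (δ.symm.trans (ν.meridian.trans δ))) :
          FundamentalGroup K.complement ν'.basePoint) =
      Abelianization.of (FundamentalGroup.fromPath (Path.Homotopic.Quotient.mk ν'.meridian)) :=
  (loopConj_meridian ν' ν).abelianizationOf_eq δ

end Knot.TubularNbhd



namespace Knot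

/-! ### Existence of the linking number -/

/-- **Existence of the linking number**: for disjoint knots `K`, `J` there is an integer `l` with
`lk(K, J) = l`, i.e. `K.HasLinkingNumber J h l`. Proof: tubular neighbourhoods exist
(`Knot.nonempty_tubularNbhd_holds`), the knot complement is path connected
(`Knot.pathConnectedSpace_complement_holds`, `LinkingNumberProofs.lean`), and `π₁(S³ ∖ K)ᵃᵇ` is
generated by the image of the meridian (`Knot.TubularNbhd.abelianization_mem_zpowers_meridian`,
`DehnSurgeryFramingProofs.lean`: the knot group is normally generated by the meridian).
Rolfsen (1976), §5.D. [cite: Rolfsen1976, §5.D] -/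
theorem HasLinkingNumber.exists (K J : Knot) (h : Disjoint (range ⇑K) (range ⇑J)) :
    ∃ l : ℤ, K.HasLinkingNumber J h l := by
  obtain ⟨ν⟩ := Knot.nonempty_tubularNbhd_holds K
  haveI : PathConnectedSpace K.complement := Knot.pathConnectedSpace_complement_holds K
  let γ : Path ν.basePoint ⟨J (circlePoint 0), mem_complement_of_disjoint h _⟩ :=
    PathConnectedSpace.somePath _ _
  obtain ⟨l, hl⟩ := Subgroup.mem_zpowers_iff.1
    (ν.abelianization_mem_zpowers_meridian (FundamentalGroup.fromPath (Path.Homotopic.Quotient.mk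
        ((γ.trans (K.loopInCompl J h)).trans γ.symm))))
  exact ⟨l, ν, γ, hl.symm⟩

/-! ### Transport between choices and uniqueness -/

/-- The conjugated loop `γ · J · γ⁻¹` at `ν₀.basePoint` is the image of the class of the loop `J`
under the inverse change-of-base-point isomorphism along `γ`. [folklore] -/
theorem fromPath_conj_loopInCompl {K J : Knot} (h : Disjoint (range ⇑K) (range ⇑J))
    (ν₀ : Knot.TubularNbhd K)
    (γ₀ : Path ν₀.basePoint ⟨J (circlePoint 0), mem_complement_of_disjoint h _⟩) :
    FundamentalGroup.fromPath (Path.Homotopic.Quotient.mk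
        ((γ₀.trans (K.loopInCompl J h)).trans γ₀.symm)) =
      (FundamentalGroup.fundamentalGroupMulEquivOfPath γ₀).symm
        (FundamentalGroup.fromPath (Path.Homotopic.Quotient.mk (K.loopInCompl J h))) := by
  rw [fundamentalGroupMulEquivOfPath_symm_fromPath]
  change Path.Homotopic.Quotient.mk _ = Path.Homotopic.Quotient.mk _
  simp only [Path.Homotopic.Quotient.mk_trans, Path.Homotopic.Quotient.mk_symm,
    Path.Homotopic.Quotient.trans_assoc]

/-- Transporting a meridian along `γ · γ'⁻¹` and reading it at `ν'.basePoint`: the element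
`Ψ_{γ'}⁻¹ (Ψ_γ [μ_ν])` is the class of `(γ γ'⁻¹)⁻¹ · μ_ν · (γ γ'⁻¹)`. [folklore] -/
theorem fromPath_meridian_transport {K : Knot} {y : K.complement} (ν ν' : Knot.TubularNbhd K)
    (γ : Path ν.basePoint y) (γ' : Path ν'.basePoint y) :
    (FundamentalGroup.fundamentalGroupMulEquivOfPath γ').symm
        (FundamentalGroup.fundamentalGroupMulEquivOfPath γ
          (FundamentalGroup.fromPath (Path.Homotopic.Quotient.mk ν.meridian))) =
      FundamentalGroup.fromPath (Path.Homotopic.Quotient.mk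
        ((γ.trans γ'.symm).symm.trans (ν.meridian.trans (γ.trans γ'.symm)))) := by
  rw [fundamentalGroupMulEquivOfPath_fromPath, fundamentalGroupMulEquivOfPath_symm_fromPath]
  change Path.Homotopic.Quotient.mk _ = Path.Homotopic.Quotient.mk _
  rw [Path.trans_symm, Path.symm_symm]
  simp only [Path.Homotopic.Quotient.mk_trans, Path.Homotopic.Quotient.mk_symm,
    Path.Homotopic.Quotient.trans_assoc]

/-- **Transport of the linking-number identity between choices**: if
`[γ · J · γ⁻¹] = l • [μ_ν]` in `H₁(S³ ∖ K)` read at `ν.basePoint`, then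
`[γ' · J · γ'⁻¹] = l • [μ_{ν'}]` read at `ν'.basePoint`, for any other oriented tubular
neighbourhood `ν'` and connecting path `γ'`: move both identities to the base point `J(1, 0)`
along `γ`, `γ'` (conjugation is invisible in the abelianisation up to the induced isomorphisms) and
compare the two oriented meridians by `TubularNbhd.abelianizationOf_conj_meridian_eq` (they are
freely homotopic in `S³ ∖ K`). Rolfsen (1976), §5.D (independence of the linking number of the
auxiliary choices). [cite: Rolfsen1976, §5.D] -/
theorem HasLinkingNumber.transport {K J : Knot}
    {h : Disjoint (range ⇑K) (range ⇑J)} {l : ℤ} (ν : Knot.TubularNbhd K)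
    (γ : Path ν.basePoint ⟨J (circlePoint 0), mem_complement_of_disjoint h _⟩)
    (e : Abelianization.of (FundamentalGroup.fromPath
        (Path.Homotopic.Quotient.mk ((γ.trans (K.loopInCompl J h)).trans γ.symm))) =
      Abelianization.of (FundamentalGroup.fromPath (Path.Homotopic.Quotient.mk ν.meridian)) ^ l)
    (ν' : Knot.TubularNbhd K)
    (γ' : Path ν'.basePoint ⟨J (circlePoint 0), mem_complement_of_disjoint h _⟩) :
    Abelianization.of (FundamentalGroup.fromPath
        (Path.Homotopic.Quotient.mk ((γ'.trans (K.loopInCompl J h)).trans γ'.symm))) =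
      Abelianization.of (FundamentalGroup.fromPath (Path.Homotopic.Quotient.mk ν'.meridian)) ^ l :=
    by
  rw [fromPath_conj_loopInCompl h ν γ] at e
  rw [fromPath_conj_loopInCompl h ν' γ']
  have f := congrArg
    (Abelianization.map (FundamentalGroup.fundamentalGroupMulEquivOfPath γ).toMonoidHom) e
  simp only [Abelianization.map_of, map_zpow, MulEquiv.coe_toMonoidHom,
    MulEquiv.apply_symm_apply] at f
  have g := congrArg
    (Abelianization.map (FundamentalGroup.fundamentalGroupMulEquivOfPath γ').symm.toMonoidHom) f
  simp only [Abelianization.map_of, map_zpow, MulEquiv.coe_toMonoidHom] at g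
  rw [g, fromPath_meridian_transport, TubularNbhd.abelianizationOf_conj_meridian_eq]

/-- **Uniqueness of the linking number**, from the infinite order of the meridian in
`H₁(S³ ∖ K)` (the named fact `Knot.TubularNbhd.zpow_meridian_injective` of
`DehnSurgeryFramingProofs.lean`, Crowell–Fox (1963), Ch. VIII (1.2); discharged in
`DehnSurgeryFramingUniqueness.lean` by Hurewicz and Mayer–Vietoris): two integers `l₁`, `l₂` with
`K.HasLinkingNumber J h lᵢ` are equal — transport both identities to the same choices `(ν₂, γ₂)`
(`HasLinkingNumber.transport`). Rolfsen (1976), §5.D. [cite: Rolfsen1976, §5.D] -/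
theorem HasLinkingNumber.unique_of (hinj : TubularNbhd.zpow_meridian_injective) {K J : Knot}
    {h : Disjoint (range ⇑K) (range ⇑J)} {l₁ l₂ : ℤ} (h₁ : K.HasLinkingNumber J h l₁)
    (h₂ : K.HasLinkingNumber J h l₂) : l₁ = l₂ := by
  obtain ⟨ν₁, γ₁, e₁⟩ := h₁
  obtain ⟨ν₂, γ₂, e₂⟩ := h₂
  have e₁' := HasLinkingNumber.transport ν₁ γ₁ e₁ ν₂ γ₂
  rw [e₁'] at e₂
  exact hinj K ν₂ e₂

/-! ### Discharge of the two named facts -/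

/-- **The linking number is well defined, from the infinite order of the meridian**: the named
fact `Knot.existsUnique_hasLinkingNumber` of `LinkingNumber.lean` (Rolfsen, *Knots and Links*
(1976), §5.D, definition (2) of `lk(K, J)` as the class of `J` in `H₁(S³ ∖ K) ≅ ℤ`, generated by
the oriented meridian) follows from the named fact `Knot.TubularNbhd.zpow_meridian_injective`
(`DehnSurgeryFramingProofs.lean`; proved as `Knot.TubularNbhd.zpow_meridian_injective_holds` in
`DehnSurgeryFramingUniqueness.lean`): existence by `HasLinkingNumber.exists` (unconditional),
uniqueness by `HasLinkingNumber.unique_of`. [cite: Rolfsen1976, §5.D] -/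
theorem existsUnique_hasLinkingNumber_of (hinj : TubularNbhd.zpow_meridian_injective) :
    existsUnique_hasLinkingNumber := fun K J h => by
  obtain ⟨l, hl⟩ := HasLinkingNumber.exists K J h
  exact ⟨l, hl, fun l' hl' => HasLinkingNumber.unique_of hinj hl' hl⟩

/-- **The linking number does not depend on the choices, proved**: the named fact
`Knot.hasLinkingNumber_iff_forall` of `LinkingNumber.lean` (Rolfsen (1976), §5.D: `lk(K, J)` is
independent of the tubular neighbourhood of `K` and of the connecting path) holds (`→`:
`HasLinkingNumber.transport`; `←`: tubular neighbourhoods and connecting paths exist).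
[cite: Rolfsen1976, §5.D] -/
theorem hasLinkingNumber_iff_forall_holds : hasLinkingNumber_iff_forall := by
  intro K J h l
  constructor
  · rintro ⟨ν, γ, e⟩ ν' γ'
    exact HasLinkingNumber.transport ν γ e ν' γ'
  · intro H
    obtain ⟨ν⟩ := Knot.nonempty_tubularNbhd_holds K
    haveI : PathConnectedSpace K.complement := Knot.pathConnectedSpace_complement_holds K
    let γ : Path ν.basePoint ⟨J (circlePoint 0), mem_complement_of_disjoint h _⟩ :=
      PathConnectedSpace.somePath _ _
    exact ⟨ν, γ, H ν γ⟩

end Knot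

end Literature.Topology.FourManifolds
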